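import Literature.Barriers.FinalStateConjecture.KleinGordonHorizonFamily
import Literature.Analysis.ODE.WronskianMatching
import Mathlib.MeasureTheory.Integral.DominatedConvergence
import Mathlib.MeasureTheory.Integral.ExpDecay
import HarnessLib

/-!
# The matching function of the horizon-regular and the Jost solution of the radial Klein–Gordon
# equation on Kerr: vanishing at the real mode, derivative formula, horizon limit, Jacobian

Topic `Literature/Barriers/FinalStateConjecture` (namespace `Literature.Barriers.FinalStateConjecture`).
The ODE core of the perturbation argument of Shlapentokh-Rothman, Comm. Math. Phys. 329 (2014),
§4.3 (Prop. 4.2, Lemma 4.5) and §4.4, in four parts (each with its own section docstring below):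

1. the real threshold mode is real and matches the Jost solution (`base_matching`);
2. the derivative of the matching function `𝒲(s) = W(y_{c(s)}, y_{∞}(ĉ(s)))(r_m)` along a `C¹`
   parameter curve (`MSetup.hasDerivAt_matchW`);
3. the horizon limit of the boundary term (`MSetup.hasDerivAt_matchW_horizon`);
4. the two real directions and the non-degeneracy of the Jacobian (`hasDerivAt_matchW_mu`,
   `hasDerivAt_matchW_omega`, `jacobian_ne_zero`).

Everything is proved.

## References

* Y. Shlapentokh-Rothman, Comm. Math. Phys. 329 (2014) 859–891, §4.2–4.4 (Prop. 4.2, Lemma 4.5).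
  Key `ShlapentokhRothman2014KleinGordon`.
* P. Hartman, *Ordinary Differential Equations*, SIAM 2002, Ch. XI §4. Key `Hartman2002`.
-/


/-!
# The real threshold mode is real: `R = P(r₊)·u`, and its matching with the Jost solution

Topic `Literature/Barriers/FinalStateConjecture` (namespace `Literature.Barriers.FinalStateConjecture`),
continuing `KleinGordonRealMode.lean` (`radRe = Re(R/P(r₊))`, the real mode) and
`KleinGordonHorizonFamily.lean` / `KleinGordonJostFamily.lean`. At the threshold parameters
`p₀ = (ω₀, λ, μ)` (real) the horizon-regular solution `R = radPair.1` of the radial ODE (2.2) is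
`P(r₊)` times a REAL function whenever `u = Re(R/P(r₊)) > 0` on `(r₊, ∞)` (the case of the mode):
with `g = Im(R/P(r₊))`, `Δ(u g' − u' g) = Im( conj(R/P(r₊)) · Δ (R/P(r₊))' )` has derivative
`Im(Δ|·'|² + (V_μ/Δ)|·|²) = 0` (`V_μ` is real), tends to `0` at `r₊` (`Δ R' → 0`, `R/P(r₊) → 1`),
so vanishes; then `(g/u)' = 0`, `g/u → 0` at `r₊`, so `g ≡ 0` (`im_radRn_eq_zero`). Consequences
(everything proved):

* `radPair_eq_real` — `R = P(r₊)·u`, `R' = P(r₊)·u'` on `(r₊, ∞)`; `yh_base_eq` — the normal form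
  `yh p₀ = P(r₊)·radV`, `yh' p₀ = P(r₊)·radV'` (`KleinGordonHorizonFamily.yh`), hence exponential
  decay of `(yh p₀, yh' p₀)` from that of the real mode (`yh_base_decay`);
* `base_matching` — **at the real mode the horizon-regular solution IS a multiple of the Jost
  solution**: `yInf p̂₀ = C · yh p₀`, `yInf' p̂₀ = C · yh' p₀` on `(R₁, ∞)` with `C ≠ 0`
  (`p̂₀ = (ω₀, λ, μ²)`; the Wronskian of two decaying solutions of the same equation is constant
  and tends to `0`), i.e. the matching function of Shlapentokh-Rothman, CMP 329 (2014), §4.3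
  vanishes at the real mode.

## References

* Y. Shlapentokh-Rothman, Comm. Math. Phys. 329 (2014) 859–891, §3.2–3.3, §4.2–4.3.
  Key `ShlapentokhRothman2014KleinGordon`.
-/

noncomputable section

open Set Filter Topology Complex
open scoped ContDiff ComplexConjugate

namespace Literature.Barriers.FinalStateConjecture

open Literature.Geometry.Lorentzian Literature.Geometry.Lorentzian.Kerr Literature.Analysis.ODE

variable {M a : ℝ} {m : ℤ}

section Base

variable (h : IsSubextremal M a) (lam μ : ℝ)
include h

/-- The normalised complex radial function `R/P(r₊)` at threshold. [folklore] -/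
def radRn (h : IsSubextremal M a) (m : ℤ) (lam μ : ℝ) (t : ℝ) : ℂ := (radPair h m lam μ).1 t / radCst M a m

/-- Its derivative `R'/P(r₊)`. [folklore] -/
def radRn' (h : IsSubextremal M a) (m : ℤ) (lam μ : ℝ) (t : ℝ) : ℂ := (radPair h m lam μ).2 t / radCst M a m

/-- `Re (R/P(r₊)) = u`, `Re (R'/P(r₊)) = u'`. [folklore] -/
theorem re_radRn (t : ℝ) : (radRn h m lam μ t).re = radRe h m lam μ t ∧ (radRn' h m lam μ t).re = radRe' h m lam μ t := ⟨rfl, rfl⟩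

/-- **The complex solved-form / flux equations for `R/P(r₊)`**:
`(R/P(r₊))' = R'/P(r₊)`, `(Δ R'/P(r₊))' = (V_μ/Δ) R/P(r₊)` on `(r₊, ∞)`. [cite: ShlapentokhRothman2014KleinGordon, §2 (2.2)] -/
theorem radRn_pair {t : ℝ} (ht : rPlus M a < t) :
    HasDerivAt (radRn h m lam μ) (radRn' h m lam μ t) t ∧
      HasDerivAt (fun s ↦ (delta M a s : ℂ) * radRn' h m lam μ s) (((kgVre M a m lam μ t / delta M a t : ℝ) : ℂ) * radRn h m lam μ t) t := by
  obtain ⟨-, -, hsol⟩ := radPair_spec (m := m) h lam μ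
  obtain ⟨h1, h2⟩ := hsol t ht
  have hΔ : 0 < delta M a t := delta_pos_of_gt h ht
  have hΔc : (delta M a t : ℂ) ≠ 0 := by exact_mod_cast hΔ.ne'
  refine ⟨?_, ?_⟩
  · show HasDerivAt (fun x ↦ (radPair h m lam μ).1 x / radCst M a m) ((radPair h m lam μ).2 t / radCst M a m) t
    exact h1.div_const _
  have h2' := h2.div_const (radCst M a m)
  have hΔd : HasDerivAt (fun s ↦ (delta M a s : ℂ)) ((((2 * (t - M) : ℝ)) : ℂ)) t := (hasDerivAt_delta M a t).ofReal_comp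
  have h3 := hΔd.mul h2'
  refine h3.congr_deriv ?_
  rw [radialQ_omega0_eq h]
  simp only [radRn]
  push_cast
  field_simp
  ring

/-- **`R/P(r₊) → 1` at the horizon.** [cite: ShlapentokhRothman2014KleinGordon, §2 (2.3)] -/
theorem tendsto_radRn_one : Tendsto (radRn h m lam μ) (𝓝[>] rPlus M a) (𝓝 1) := by
  have hc := hzC_pos h
  set F : ℝ → ℂ := fun s ↦ hzPhase M a m (kgOmega0 M a m) s * hzRhoC M a m (kgOmega0 M a m) (lam : ℂ) μ (s : ℂ) / radCst M a m with hF
  have hFcont : ContinuousAt F (rPlus M a) := by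
    have hP : ContinuousAt (hzPhase M a m (kgOmega0 M a m)) (rPlus M a) := continuousAt_hzPhase_omega0 (m := m) h h.rMinus_lt_rPlus
    have habs : |((((lam, μ) : ℝ × ℝ), rPlus M a) : (ℝ × ℝ) × ℝ).2 - rPlus M a| < 2 * hzC M a / 5 := by
      simp only [sub_self, abs_zero]; positivity
    have hemb : ContinuousAt (fun s : ℝ ↦ ((((lam, μ) : ℝ × ℝ), s) : (ℝ × ℝ) × ℝ)) (rPlus M a) :=
      (continuous_const.prodMk continuous_id).continuousAt
    have hρ : ContinuousAt (fun s : ℝ ↦ hzRhoC M a m (kgOmega0 M a m) (lam : ℂ) μ (s : ℂ)) (rPlus M a) :=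
      ContinuousAt.comp (f := fun s : ℝ ↦ ((((lam, μ) : ℝ × ℝ), s) : (ℝ × ℝ) × ℝ)) (continuousAt_hzRhoC_joint (m := m) h habs) hemb
    exact (hP.mul hρ).div_const _
  have hF0 : F (rPlus M a) = 1 := by
    simp only [hF, radCst, hzRhoC, hzXi, sub_self, zero_div, heunFun_zero, mul_one]
    exact div_self (hzPhase_ne_zero _)
  have hlim : Tendsto F (𝓝[>] rPlus M a) (𝓝 1) := by
    have := hFcont.tendsto
    rw [hF0] at this
    exact this.mono_left nhdsWithin_le_nhds
  have heq : ∀ᶠ s in 𝓝[>] rPlus M a, F s = radRn h m lam μ s := by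
    have hI : Ioo (rPlus M a) (rPlus M a + 2 * hzC M a / 5) ∈ 𝓝[>] rPlus M a := Ioo_mem_nhdsGT (by linarith)
    filter_upwards [hI] with s hs
    rw [radRn, (radPair_eqOn (m := m) h lam μ).1 hs, hzRloc]
  exact hlim.congr' heq

/-- **The complex horizon flux vanishes**: `Δ R'/P(r₊) → 0` at `r₊`. [cite: ShlapentokhRothman2014KleinGordon, §3.2] -/
theorem tendsto_cflux_zero : Tendsto (fun s ↦ (delta M a s : ℂ) * radRn' h m lam μ s) (𝓝[>] rPlus M a) (𝓝 0) := by
  have hc := hzC_pos h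
  set F : ℝ → ℂ := fun s ↦ hzPhase M a m (kgOmega0 M a m) s *
      ((delta M a s : ℂ) * hzRhoC' M a m (kgOmega0 M a m) (lam : ℂ) μ (s : ℂ) -
        I * hzK a m (kgOmega0 M a m : ℂ) s * hzRhoC M a m (kgOmega0 M a m) (lam : ℂ) μ (s : ℂ)) / radCst M a m with hF
  have hFcont : ContinuousAt F (rPlus M a) := by
    have hP : ContinuousAt (hzPhase M a m (kgOmega0 M a m)) (rPlus M a) := continuousAt_hzPhase_omega0 (m := m) h h.rMinus_lt_rPlus
    have habs : |((((lam, μ) : ℝ × ℝ), rPlus M a) : (ℝ × ℝ) × ℝ).2 - rPlus M a| < 2 * hzC M a / 5 := by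
      simp only [sub_self, abs_zero]; positivity
    have hemb : ContinuousAt (fun s : ℝ ↦ ((((lam, μ) : ℝ × ℝ), s) : (ℝ × ℝ) × ℝ)) (rPlus M a) :=
      (continuous_const.prodMk continuous_id).continuousAt
    have hρ : ContinuousAt (fun s : ℝ ↦ hzRhoC M a m (kgOmega0 M a m) (lam : ℂ) μ (s : ℂ)) (rPlus M a) :=
      ContinuousAt.comp (f := fun s : ℝ ↦ ((((lam, μ) : ℝ × ℝ), s) : (ℝ × ℝ) × ℝ)) (continuousAt_hzRhoC_joint (m := m) h habs) hemb
    have hρ' : ContinuousAt (fun s : ℝ ↦ hzRhoC' M a m (kgOmega0 M a m) (lam : ℂ) μ (s : ℂ)) (rPlus M a) :=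
      ContinuousAt.comp (f := fun s : ℝ ↦ ((((lam, μ) : ℝ × ℝ), s) : (ℝ × ℝ) × ℝ)) (continuousAt_hzRhoC'_joint (m := m) h habs) hemb
    have hΔ : ContinuousAt (fun s : ℝ ↦ (delta M a s : ℂ)) (rPlus M a) := by
      have : Continuous fun s : ℝ ↦ (delta M a s : ℂ) := by unfold delta; fun_prop
      exact this.continuousAt
    have hK : ContinuousAt (fun s : ℝ ↦ hzK a m (kgOmega0 M a m : ℂ) s) (rPlus M a) := by
      have : Continuous fun s : ℝ ↦ hzK a m (kgOmega0 M a m : ℂ) s := by unfold hzK; fun_prop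
      exact this.continuousAt
    exact ((hP.mul ((hΔ.mul hρ').sub ((continuousAt_const.mul hK).mul hρ))).div_const _)
  have hF0 : F (rPlus M a) = 0 := by
    simp only [hF, delta_rPlus h.le, hzK_omega0_rPlus (m := m) h, Complex.ofReal_zero, zero_mul, mul_zero, sub_zero, zero_div]
  have hlim : Tendsto F (𝓝[>] rPlus M a) (𝓝 0) := by
    have := hFcont.tendsto
    rw [hF0] at this
    exact this.mono_left nhdsWithin_le_nhds
  have heq : ∀ᶠ s in 𝓝[>] rPlus M a, F s = (delta M a s : ℂ) * radRn' h m lam μ s := by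
    have hI : Ioo (rPlus M a) (rPlus M a + 2 * hzC M a / 5) ∈ 𝓝[>] rPlus M a := Ioo_mem_nhdsGT (by linarith)
    filter_upwards [hI] with s hs
    have hΔ0 : (delta M a s : ℂ) ≠ 0 := by exact_mod_cast (delta_pos_of_gt h hs.1).ne'
    rw [radRn', (radPair_eqOn (m := m) h lam μ).2 hs, hzRloc', hF]
    field_simp
  exact hlim.congr' heq

/-- **The weighted Wronskian `Im( conj(R/P(r₊)) · Δ R'/P(r₊) )` is constant** on `(r₊, ∞)`
(its derivative is the imaginary part of the real number `Δ|·'|² + (V_μ/Δ)|·|²`). [folklore] -/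
theorem hasDerivAt_imWronskian {t : ℝ} (ht : rPlus M a < t) :
    HasDerivAt (fun s ↦ (conj (radRn h m lam μ s) * ((delta M a s : ℂ) * radRn' h m lam μ s)).im) 0 t := by
  obtain ⟨h1, h2⟩ := radRn_pair (m := m) h lam μ ht
  have hc : HasDerivAt (fun s ↦ conj (radRn h m lam μ s)) (conj (radRn' h m lam μ t)) t := by
    simpa only [starRingEnd_apply] using HasDerivAt.star h1
  have hm := hc.mul h2
  have him : HasDerivAt (fun s ↦ (conj (radRn h m lam μ s) * ((delta M a s : ℂ) * radRn' h m lam μ s)).im)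
      (conj (radRn' h m lam μ t) * ((delta M a t : ℂ) * radRn' h m lam μ t) +
        conj (radRn h m lam μ t) * ((((kgVre M a m lam μ t / delta M a t : ℝ)) : ℂ) * radRn h m lam μ t)).im t := by
    have h1 := Complex.imCLM.hasFDerivAt.comp_hasDerivAt t hm
    simpa [Function.comp_def] using h1
  refine him.congr_deriv ?_
  rw [Complex.add_im]
  have e1 : (conj (radRn' h m lam μ t) * ((delta M a t : ℂ) * radRn' h m lam μ t)).im = 0 := by
    rw [show conj (radRn' h m lam μ t) * ((delta M a t : ℂ) * radRn' h m lam μ t) =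
      (delta M a t : ℂ) * (radRn' h m lam μ t * conj (radRn' h m lam μ t)) by ring, Complex.mul_conj]
    simp [Complex.mul_im]
  have e2 : (conj (radRn h m lam μ t) * ((((kgVre M a m lam μ t / delta M a t : ℝ)) : ℂ) * radRn h m lam μ t)).im = 0 := by
    rw [show conj (radRn h m lam μ t) * ((((kgVre M a m lam μ t / delta M a t : ℝ)) : ℂ) * radRn h m lam μ t) =
      (((kgVre M a m lam μ t / delta M a t : ℝ)) : ℂ) * (radRn h m lam μ t * conj (radRn h m lam μ t)) by ring, Complex.mul_conj]
    simp [Complex.mul_im]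
  rw [e1, e2, add_zero]

/-- The weighted Wronskian vanishes identically on `(r₊, ∞)` (constant, and `→ 0` at `r₊`). [folklore] -/
theorem imWronskian_eq_zero {t : ℝ} (ht : rPlus M a < t) :
    (conj (radRn h m lam μ t) * ((delta M a t : ℂ) * radRn' h m lam μ t)).im = 0 := by
  set Wf : ℝ → ℝ := fun s ↦ (conj (radRn h m lam μ s) * ((delta M a s : ℂ) * radRn' h m lam μ s)).im with hWf
  -- constant on `(r₊, ∞)`
  have hconst : ∀ s, rPlus M a < s → Wf s = Wf t := fun s hs ↦
    isOpen_Ioi.is_const_of_deriv_eq_zero isPreconnected_Ioi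
      (fun x hx ↦ (hasDerivAt_imWronskian (m := m) h lam μ hx).differentiableAt.differentiableWithinAt)
      (fun x hx ↦ (hasDerivAt_imWronskian (m := m) h lam μ hx).deriv) hs ht
  -- tends to `0` at `r₊`
  have hlim : Tendsto Wf (𝓝[>] rPlus M a) (𝓝 0) := by
    have h1 := tendsto_radRn_one (m := m) h lam μ
    have h2 := tendsto_cflux_zero (m := m) h lam μ
    have h3 : Tendsto (fun s ↦ conj (radRn h m lam μ s) * ((delta M a s : ℂ) * radRn' h m lam μ s)) (𝓝[>] rPlus M a) (𝓝 (conj 1 * 0)) :=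
      ((Complex.continuous_conj.tendsto 1).comp h1).mul h2
    rw [mul_zero] at h3
    have h4 := (Complex.continuous_im.tendsto 0).comp h3
    rw [Complex.zero_im] at h4
    exact h4
  have hev : Wf =ᶠ[𝓝[>] rPlus M a] fun _ ↦ Wf t := by
    filter_upwards [self_mem_nhdsWithin] with s hs using hconst s hs
  have h5 : Tendsto (fun _ : ℝ ↦ Wf t) (𝓝[>] rPlus M a) (𝓝 0) := hlim.congr' hev
  exact (tendsto_nhds_unique tendsto_const_nhds h5)

/-- **The horizon-regular threshold solution is real when `u > 0`**: `Im(R/P(r₊)) ≡ 0` and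
`Im(R'/P(r₊)) ≡ 0` on `(r₊, ∞)`. [cite: ShlapentokhRothman2014KleinGordon, §4.2] -/
theorem im_radRn_eq_zero (hpos : ∀ t ∈ Ioi (rPlus M a), 0 < radRe h m lam μ t) :
    ∀ t ∈ Ioi (rPlus M a), (radRn h m lam μ t).im = 0 ∧ (radRn' h m lam μ t).im = 0 := by
  set f : ℝ → ℝ := radRe h m lam μ with hf
  set f' : ℝ → ℝ := radRe' h m lam μ with hf'
  set g : ℝ → ℝ := fun t ↦ (radRn h m lam μ t).im with hg
  set g' : ℝ → ℝ := fun t ↦ (radRn' h m lam μ t).im with hg'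
  have hfd : ∀ t, rPlus M a < t → HasDerivAt f (f' t) t := fun t ht ↦ (radRe_hasDerivAt (m := m) h lam μ ht).1
  have hgd : ∀ t, rPlus M a < t → HasDerivAt g (g' t) t := fun t ht ↦ by
    have h1 := (radRn_pair (m := m) h lam μ ht).1
    have h2 := Complex.imCLM.hasFDerivAt.comp_hasDerivAt t h1
    simpa [Function.comp_def] using h2
  -- `f g' − f' g = 0`
  have hW : ∀ t, rPlus M a < t → f t * g' t - f' t * g t = 0 := by
    intro t ht
    have hΔ : 0 < delta M a t := delta_pos_of_gt h ht
    have h0 := imWronskian_eq_zero (m := m) h lam μ ht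
    have hexp : (conj (radRn h m lam μ t) * ((delta M a t : ℂ) * radRn' h m lam μ t)).im = delta M a t * (f t * g' t - f' t * g t) := by
      simp only [Complex.mul_im, Complex.mul_re, Complex.conj_re, Complex.conj_im, Complex.ofReal_re, Complex.ofReal_im, hf, hf', hg,
        hg', radRe, radRe', radRn, radRn']
      ring
    rw [hexp] at h0
    rcases mul_eq_zero.1 h0 with h0 | h0
    · exact absurd h0 hΔ.ne'
    · exact h0
  -- `g/f` is constant
  have hq : ∀ t, rPlus M a < t → HasDerivAt (fun s ↦ g s / f s) 0 t := by
    intro t ht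
    have hft : f t ≠ 0 := (hpos t ht).ne'
    have hd := (hgd t ht).div (hfd t ht) hft
    refine hd.congr_deriv ?_
    rw [show g' t * f t - g t * f' t = f t * g' t - f' t * g t by ring, hW t ht, zero_div]
  obtain ⟨t₁, ht₁⟩ : ∃ t₁, rPlus M a < t₁ := ⟨rPlus M a + 1, by linarith⟩
  have hconst : ∀ s, rPlus M a < s → g s / f s = g t₁ / f t₁ := fun s hs ↦
    isOpen_Ioi.is_const_of_deriv_eq_zero isPreconnected_Ioi (fun x hx ↦ (hq x hx).differentiableAt.differentiableWithinAt)
      (fun x hx ↦ (hq x hx).deriv) hs ht₁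
  -- the constant is `0`: `g/f → 0/1` at `r₊`
  have hlim : Tendsto (fun s ↦ g s / f s) (𝓝[>] rPlus M a) (𝓝 0) := by
    have h1 := tendsto_radRn_one (m := m) h lam μ
    have hgl : Tendsto g (𝓝[>] rPlus M a) (𝓝 0) := by
      have h2 := (Complex.continuous_im.tendsto 1).comp h1
      rw [Complex.one_im] at h2
      exact h2
    have hfl : Tendsto f (𝓝[>] rPlus M a) (𝓝 1) := by
      have h2 := (Complex.continuous_re.tendsto 1).comp h1
      rw [Complex.one_re] at h2
      exact h2
    have h3 := hgl.div hfl one_ne_zero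
    rw [zero_div] at h3
    exact h3
  have hk : g t₁ / f t₁ = 0 := by
    have hev : (fun s ↦ g s / f s) =ᶠ[𝓝[>] rPlus M a] fun _ ↦ g t₁ / f t₁ := by
      filter_upwards [self_mem_nhdsWithin] with s hs using hconst s hs
    exact tendsto_nhds_unique (hlim.congr' hev) tendsto_const_nhds |>.symm
  have hg0 : ∀ t, rPlus M a < t → g t = 0 := fun t ht ↦ by
    have := hconst t ht
    rw [hk, div_eq_zero_iff] at this
    exact this.resolve_right (hpos t ht).ne'
  intro t ht
  refine ⟨hg0 t ht, ?_⟩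
  -- `g' t = 0`: `g` vanishes near `t`
  have hev : g =ᶠ[𝓝 t] fun _ ↦ (0 : ℝ) := by
    filter_upwards [Ioi_mem_nhds ht] with s hs using hg0 s hs
  have h0 : HasDerivAt g 0 t := (hasDerivAt_const t (0 : ℝ)).congr_of_eventuallyEq hev
  exact (hgd t ht).unique h0

/-- **`R = P(r₊)·u` and `R' = P(r₊)·u'`** on `(r₊, ∞)` at a threshold parameter with `u > 0`. [cite: ShlapentokhRothman2014KleinGordon, §4.2] -/
theorem radPair_eq_real (hpos : ∀ t ∈ Ioi (rPlus M a), 0 < radRe h m lam μ t) {t : ℝ} (ht : rPlus M a < t) :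
    (radPair h m lam μ).1 t = radCst M a m * (radRe h m lam μ t : ℂ) ∧ (radPair h m lam μ).2 t = radCst M a m * (radRe' h m lam μ t : ℂ) := by
  obtain ⟨hi, hi'⟩ := im_radRn_eq_zero (m := m) h lam μ hpos t ht
  have hc := radCst_ne_zero (M := M) (a := a) (m := m)
  have e1 : radRn h m lam μ t = (radRe h m lam μ t : ℂ) := Complex.ext (by simp [radRe, radRn]) (by simpa using hi)
  have e2 : radRn' h m lam μ t = (radRe' h m lam μ t : ℂ) := Complex.ext (by simp [radRe', radRn']) (by simpa using hi')
  unfold radRn at e1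
  unfold radRn' at e2
  constructor
  · rw [← e1]; field_simp
  · rw [← e2]; field_simp

/-- **The normal form of the horizon family at the threshold point** `p₀ = (ω₀, λ, μ)`:
`yh p₀ = P(r₊)·radV`, `yh' p₀ = P(r₊)·radV'` on `(r₊, ∞)`. [folklore] -/
theorem yh_base_eq (hpos : ∀ t ∈ Ioi (rPlus M a), 0 < radRe h m lam μ t) {t : ℝ} (ht : rPlus M a < t) :
    yh h m (((kgOmega0 M a m : ℂ), (lam : ℂ), μ) : HPar) t = radCst M a m * (radV h m lam μ t : ℂ) ∧
      yh' h m (((kgOmega0 M a m : ℂ), (lam : ℂ), μ) : HPar) t = radCst M a m * (radV' h m lam μ t : ℂ) := by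
  obtain ⟨b1, b2⟩ := hPair_base (m := m) h lam μ
  obtain ⟨e1, e2⟩ := radPair_eq_real (m := m) h lam μ hpos ht
  simp only [yh, yh', b1 ht, b2 ht, e1, e2, radV, radV']
  push_cast
  constructor <;> ring

/-- **Exponential decay of `(yh p₀, yh' p₀)`** from that of the real mode. [folklore] -/
theorem yh_base_decay (hpos : ∀ t ∈ Ioi (rPlus M a), 0 < radRe h m lam μ t) {C k S₁ : ℝ} (hS₁ : rPlus M a < S₁)
    (hdec : ∀ t : ℝ, S₁ ≤ t → |radV h m lam μ t| ≤ C * Real.exp (-(k * t)) ∧ |radV' h m lam μ t| ≤ C * Real.exp (-(k * t))) :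
    ∀ t : ℝ, S₁ ≤ t → ‖yh h m (((kgOmega0 M a m : ℂ), (lam : ℂ), μ) : HPar) t‖ ≤ ‖radCst M a m‖ * C * Real.exp (-(k * t)) ∧
      ‖yh' h m (((kgOmega0 M a m : ℂ), (lam : ℂ), μ) : HPar) t‖ ≤ ‖radCst M a m‖ * C * Real.exp (-(k * t)) := by
  intro t ht
  obtain ⟨e1, e2⟩ := yh_base_eq (m := m) h lam μ hpos (lt_of_lt_of_le hS₁ ht)
  obtain ⟨d1, d2⟩ := hdec t ht
  rw [e1, e2, norm_mul, norm_mul, Complex.norm_real, Complex.norm_real, Real.norm_eq_abs, Real.norm_eq_abs]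
  have i1 := mul_le_mul_of_nonneg_left d1 (norm_nonneg (radCst M a m))
  have i2 := mul_le_mul_of_nonneg_left d2 (norm_nonneg (radCst M a m))
  constructor <;> linarith

end Base

/-! ### Matching with the Jost solution at the real mode -/

section Matching

variable (h : IsSubextremal M a) (m) {γ₀ : ℂ} {γ₁ : ℝ} (h₁ : 0 ≤ γ₁) (hγ : γ₁ < γ₀.re) {R₁ : ℝ} (hR : 20 * (rPlus M a + M) ≤ R₁) (hR1 : 1 ≤ R₁)

/-- The complexified threshold parameter `p̂₀ = (ω₀, λ, μ²)`. [folklore] -/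
abbrev pHat (M a : ℝ) (m : ℤ) (lam μ : ℝ) : ℂ × ℂ × ℂ := ((kgOmega0 M a m : ℂ), (lam : ℂ), (((μ ^ 2 : ℝ)) : ℂ))

/-- **Base matching.** At a threshold parameter `(ω₀, λ, μ)` with `u > 0` and exponentially
decaying real mode, and for a Jost family with `C_K‖jw p̂₀‖ < 1`, the Jost solution is a non-zero
multiple of the horizon-regular solution on `(R₁, ∞)`: `yInf p̂₀ = C · yh p₀`, `yInf' p̂₀ = C · yh' p₀`,
`C ≠ 0` — the matching function vanishes at the real mode. [cite: ShlapentokhRothman2014KleinGordon, §4.3] -/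
theorem base_matching {lam μ : ℝ} (hpos : ∀ t ∈ Ioi (rPlus M a), 0 < radRe h m lam μ t) {C k S₁ : ℝ} (hk : 0 < k) (hS₁ : rPlus M a < S₁)
    (hdec : ∀ t : ℝ, S₁ ≤ t → |radV h m lam μ t| ≤ C * Real.exp (-(k * t)) ∧ |radV' h m lam μ t| ≤ C * Real.exp (-(k * t)))
    (hw : jostKconst γ₀ γ₁ * ‖jw m h γ₀ hR hR1 (pHat M a m lam μ)‖ < 1) :
    ∃ Cm : ℂ, Cm ≠ 0 ∧
      EqOn (yInf m h hR hR1 h₁ hγ (pHat M a m lam μ)) (fun t ↦ Cm * yh h m (((kgOmega0 M a m : ℂ), (lam : ℂ), μ) : HPar) t) (Ioi R₁) ∧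
      EqOn (yInf' m h hR hR1 h₁ hγ (pHat M a m lam μ)) (fun t ↦ Cm * yh' h m (((kgOmega0 M a m : ℂ), (lam : ℂ), μ) : HPar) t) (Ioi R₁) := by
  set p₀ : HPar := ((kgOmega0 M a m : ℂ), (lam : ℂ), μ) with hp₀
  have hRr : rPlus M a < R₁ := (delta_ge_of_far h hR).2.2.1
  -- both solve `y'' = kgQc(·; p̂₀) y` on `(R₁, ∞)`
  have hyh : IsSol2 (kgQc M a m (kgOmega0 M a m : ℂ) (lam : ℂ) (((μ ^ 2 : ℝ)) : ℂ)) (yh h m p₀) (yh' h m p₀) (Ioi R₁) :=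
    (isSol2_yh (m := m) h p₀).mono (Ioi_subset_Ioi hRr.le)
  have e1 : (pHat M a m lam μ).1 = (kgOmega0 M a m : ℂ) := rfl
  have e2 : (pHat M a m lam μ).2.1 = (lam : ℂ) := rfl
  have e3 : (pHat M a m lam μ).2.2 = (((μ ^ 2 : ℝ)) : ℂ) := rfl
  have hyi := isSol2_yInf m h hR hR1 h₁ hγ hw
  rw [e1, e2, e3] at hyi
  have hQ : ContinuousOn (kgQc M a m (kgOmega0 M a m : ℂ) (lam : ℂ) (((μ ^ 2 : ℝ)) : ℂ)) (Ioi R₁) :=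
    (continuousOn_kgQc h _ _ _).mono (Ioi_subset_Ioi hRr.le)
  -- the Wronskian tends to zero (both pairs decay), and is constant, hence vanishes
  have hdec1 := yh_base_decay (m := m) h lam μ hpos hS₁ hdec
  set S₂ := max S₁ R₁ with hS₂
  set Ci : ℝ := max (1 / (1 - jostKconst γ₀ γ₁ * ‖jw m h γ₀ hR hR1 (pHat M a m lam μ)‖))
    (‖γ₀‖ + 1 / 2 * (1 / (γ₀.re - γ₁) + 1 / (γ₀.re + γ₁)) *
      (‖jw m h γ₀ hR hR1 (pHat M a m lam μ)‖ * (1 / (1 - jostKconst γ₀ γ₁ * ‖jw m h γ₀ hR hR1 (pHat M a m lam μ)‖)))) with hCi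
  have hlim : Tendsto (wronskian (yh h m p₀) (yh' h m p₀) (yInf m h hR hR1 h₁ hγ (pHat M a m lam μ)) (yInf' m h hR hR1 h₁ hγ (pHat M a m lam μ)))
      atTop (𝓝 0) := by
    refine tendsto_wronskian_zero_of_decay (κ := k) (κ' := γ₁) (C := ‖radCst M a m‖ * C) (C' := Ci * Real.exp (γ₁ * R₁)) (T := S₂)
      (by linarith) (fun t ht ↦ hdec1 t (le_trans (le_max_left _ _) ht)) (fun t ht ↦ ?_)
    have htR : R₁ ≤ t := le_trans (le_max_right _ _) ht
    have e : Real.exp (-(γ₁ * (t - R₁))) = Real.exp (γ₁ * R₁) * Real.exp (-(γ₁ * t)) := by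
      rw [← Real.exp_add]; congr 1; ring
    have n1 := norm_yInf_le m h hR hR1 h₁ hγ hw t
    have n2 := norm_yInf'_le m h hR hR1 h₁ hγ hw htR
    rw [e] at n1 n2
    constructor
    · calc _ ≤ _ := n1
        _ ≤ Real.exp (γ₁ * R₁) * Real.exp (-(γ₁ * t)) * Ci := mul_le_mul_of_nonneg_left (le_max_left _ _) (by positivity)
        _ = Ci * Real.exp (γ₁ * R₁) * Real.exp (-(γ₁ * t)) := by ring
    · calc _ ≤ _ := n2
        _ ≤ Real.exp (γ₁ * R₁) * Real.exp (-(γ₁ * t)) * Ci := mul_le_mul_of_nonneg_left (le_max_right _ _) (by positivity)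
        _ = Ci * Real.exp (γ₁ * R₁) * Real.exp (-(γ₁ * t)) := by ring
  have hW0 : ∀ t, R₁ < t → wronskian (yh h m p₀) (yh' h m p₀) (yInf m h hR hR1 h₁ hγ (pHat M a m lam μ))
      (yInf' m h hR hR1 h₁ hγ (pHat M a m lam μ)) t = 0 := by
    intro t ht
    have hev : (wronskian (yh h m p₀) (yh' h m p₀) (yInf m h hR hR1 h₁ hγ (pHat M a m lam μ)) (yInf' m h hR hR1 h₁ hγ (pHat M a m lam μ)))
        =ᶠ[atTop] fun _ ↦ wronskian (yh h m p₀) (yh' h m p₀) (yInf m h hR hR1 h₁ hγ (pHat M a m lam μ))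
          (yInf' m h hR hR1 h₁ hγ (pHat M a m lam μ)) t := by
      filter_upwards [eventually_gt_atTop R₁] with s hs using hyh.wronskian_eq hyi hs ht
    exact tendsto_nhds_unique tendsto_const_nhds (hlim.congr' hev)
  -- `yh p₀` has non-zero value at `R₁ + 1`
  have ht1 : rPlus M a < R₁ + 1 := by linarith
  have hne : yh h m p₀ (R₁ + 1) ≠ 0 ∨ yh' h m p₀ (R₁ + 1) ≠ 0 := by
    left
    rw [(yh_base_eq (m := m) h lam μ hpos ht1).1, radV]
    refine mul_ne_zero radCst_ne_zero ?_
    have hs : 0 < Real.sqrt (delta M a (R₁ + 1)) := Real.sqrt_pos.2 (delta_pos_of_gt h ht1)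
    exact_mod_cast (mul_pos hs (hpos _ ht1)).ne'
  obtain ⟨Cm, hC1, hC2⟩ := hyh.exists_eq_smul_of_wronskian_eq_zero hQ hyi (by linarith) (hW0 (R₁ + 1) (by linarith)) hne
  refine ⟨Cm, ?_, hC1, hC2⟩
  -- `Cm ≠ 0` since the Jost solution is not identically zero
  rintro rfl
  obtain ⟨r, hr, hne0⟩ := exists_yInf_ne_zero m h hR hR1 h₁ hγ hw
  have h0 := hC1 hr
  simp only [zero_mul] at h0
  exact hne0 h0

end Matching

end Literature.Barriers.FinalStateConjecture

end


/-!
# The matching function of the horizon-regular and the Jost solution along a parameter curve: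
# the derivative formula

Topic `Literature/Barriers/FinalStateConjecture` (namespace `Literature.Barriers.FinalStateConjecture`),
continuing `KleinGordonThresholdMode.lean`. Shlapentokh-Rothman, CMP 329 (2014), §4.3
(Lemma 4.5 / Prop. 4.2) perturbs the real threshold mode into the upper half plane by the
implicit function theorem applied to a matching condition; the non-degeneracy of that condition is
a computation of the derivatives of the matching function in the parameters. This file proves the
GENERAL DERIVATIVE FORMULA of the matching function `𝒲(s) = W(y_{c(s)}, y_∞(ĉ(s)))(r_m)`
(`matchW`) along a `C¹` parameter curve `c : ℝ → (ω, Λ, μ)` through the threshold point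
`c(0) = p₀ = (ω₀, λ, μ)` at which the real mode is positive and decaying (`base_matching`:
`y_∞ = C_m y_{p₀}` beyond `R₁`):

* the difference quotient of the potential along the curve, `DQ s r = (q_{c s}(r) − q_{c 0}(r))/s`,
  extended continuously to `s = 0` by `q̇(r) = DQ 0 r` (`DQ`, via divided differences `dd` of the
  `C¹` coefficient functions; jointly continuous, uniformly bounded on `r ≥ R₁`);
* `hasDerivAt_matchW` — for every `r_h ∈ (r₊, r_m)`:
  `𝒲'(0) = C_m (β(r_h) − ∫_{r_h}^{r_m} q̇ y₀²) − C_m ∫_{(r_m, ∞)} q̇ y₀²`, where `y₀ = y_{p₀}` and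
  `β(r_h) = W(ẏ, y₀)(r_h)`, `ẏ = ∂ₛ y_{c s}|₀` (values); the proof expands the Wronskian bilinearly
  (`WronskianMatching.wronskian_expand`), represents `W(y_s, y₀)` and `W(y₀, y_{∞,s})` as integrals
  of `(q₀ − q_s) y_s y₀` (`wronskian_sub_eq_integral`, `wronskian_eq_neg_integral_Ioi`) and passes
  to the limit `s → 0` by continuity of parametric integrals (compact part) and dominated
  convergence (tail; the Jost family is uniformly exponentially bounded).

The horizon limit `r_h → r₊` of `β` and the explicit values in the two directions used by the
implicit function theorem are in `KleinGordonMatchingHorizon.lean`. Everything is proved.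

## References

* Y. Shlapentokh-Rothman, Comm. Math. Phys. 329 (2014) 859–891, §4.3 (Lemma 4.5, Prop. 4.2).
  Key `ShlapentokhRothman2014KleinGordon`.
* P. Hartman, *Ordinary Differential Equations*, SIAM 2002, Ch. XI §4. Key `Hartman2002`.
-/

noncomputable section

open Set Filter Topology Complex MeasureTheory
open scoped ContDiff

namespace Literature.Barriers.FinalStateConjecture

open Literature.Geometry.Lorentzian Literature.Geometry.Lorentzian.Kerr Literature.Analysis.ODE

variable {M a : ℝ} {m : ℤ}

/-! ### Jost data and the complexification map -/

/-- **Jost data**: the rate `γ₀` (`Re γ₀ > γ₁ ≥ 0`) and the freezing radius `R₁ ≥ max(1, 20(r₊+M))`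
of a Jost family (`KleinGordonJostFamily.lean`). [folklore] -/
structure JD (M a : ℝ) where
  /-- the exponential rate -/
  γ₀ : ℂ
  /-- the guaranteed decay rate -/
  γ₁ : ℝ
  /-- the freezing radius -/
  R₁ : ℝ
  h₁ : 0 ≤ γ₁
  hγ : γ₁ < γ₀.re
  hR : 20 * (rPlus M a + M) ≤ R₁
  hR1 : 1 ≤ R₁

/-- The complexification `(ω, Λ, μ) ↦ (ω, Λ, μ²)` of the parameters (the Jost family is holomorphic
in the complex mass-square). [folklore] -/
def toJ (p : HPar) : ℂ × ℂ × ℂ := (p.1, p.2.1, (((p.2.2 ^ 2 : ℝ)) : ℂ))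

/-- `toJ` is smooth. [folklore] -/
theorem contDiff_toJ {n : WithTop ℕ∞} : ContDiff ℝ n toJ := by
  unfold toJ; fun_prop

/-- Components of `toJ`. [folklore] -/
@[simp] theorem toJ_fst (p : HPar) : (toJ p).1 = p.1 := rfl
/-- Components of `toJ`. [folklore] -/
@[simp] theorem toJ_snd_fst (p : HPar) : (toJ p).2.1 = p.2.1 := rfl
/-- Components of `toJ`. [folklore] -/
@[simp] theorem toJ_snd_snd (p : HPar) : (toJ p).2.2 = (((p.2.2 ^ 2 : ℝ)) : ℂ) := rfl

/-- The Jost family attached to Jost data (abbreviation of `yInf`). [folklore] -/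
def yI (m : ℤ) (h : IsSubextremal M a) (J : JD M a) (p : ℂ × ℂ × ℂ) (r : ℝ) : ℂ := yInf m h J.hR J.hR1 J.h₁ J.hγ p r

/-- Its derivative. [folklore] -/
def yI' (m : ℤ) (h : IsSubextremal M a) (J : JD M a) (p : ℂ × ℂ × ℂ) (r : ℝ) : ℂ := yInf' m h J.hR J.hR1 J.h₁ J.hγ p r

/-- The smallness quantity `C_K ‖jw p‖` of the Jost family. [folklore] -/
def jsmall (m : ℤ) (h : IsSubextremal M a) (J : JD M a) (p : ℂ × ℂ × ℂ) : ℝ := jostKconst J.γ₀ J.γ₁ * ‖jw m h J.γ₀ J.hR J.hR1 p‖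

/-- `jsmall` is continuous. [folklore] -/
theorem continuous_jsmall (h : IsSubextremal M a) (J : JD M a) : Continuous (jsmall m h J) :=
  continuous_const.mul ((contDiff_jw m h J.γ₀ J.hR J.hR1 (n := 0)).continuous.norm)

/-! ### Divided differences -/

/-- The divided difference of `g` at `0`, extended by `g'(0)`. [folklore] -/
def dd (g : ℝ → ℂ) (s : ℝ) : ℂ := if s = 0 then deriv g 0 else (g s - g 0) / s

/-- Value off `0`. [folklore] -/
theorem dd_of_ne (g : ℝ → ℂ) {s : ℝ} (hs : s ≠ 0) : dd g s = (g s - g 0) / s := if_neg hs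

/-- Value at `0`. [folklore] -/
theorem dd_zero (g : ℝ → ℂ) : dd g 0 = deriv g 0 := if_pos rfl

/-- **The divided difference of a `C¹` function is continuous.** [folklore] -/
theorem continuous_dd {g : ℝ → ℂ} (hg : ContDiff ℝ 1 g) : Continuous (dd g) := by
  rw [continuous_iff_continuousAt]
  intro s
  by_cases hs : s = 0
  · subst hs
    -- at `0`: the slope tends to the derivative
    have hd : HasDerivAt g (deriv g 0) 0 := (hg.differentiable one_ne_zero 0).hasDerivAt
    have hsl := hasDerivAt_iff_tendsto_slope.1 hd
    rw [ContinuousAt, dd_zero]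
    have hev : slope g 0 =ᶠ[𝓝[≠] (0 : ℝ)] dd g := by
      filter_upwards [self_mem_nhdsWithin] with s hs
      rw [dd_of_ne g hs, slope_def_module]
      simp [sub_zero, div_eq_inv_mul]
    have h1 : Tendsto (dd g) (𝓝[≠] (0 : ℝ)) (𝓝 (deriv g 0)) := hsl.congr' hev
    -- combine with the value at `0`
    have h2 : Tendsto (dd g) (pure (0 : ℝ)) (𝓝 (deriv g 0)) := by
      rw [tendsto_pure_left]; intro U hU; rw [dd_zero]; exact mem_of_mem_nhds hU
    have := h1.sup h2
    rwa [nhdsNE_sup_pure] at this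
  · have hev : dd g =ᶠ[𝓝 s] fun t ↦ (g t - g 0) / t := by
      filter_upwards [isOpen_ne.mem_nhds hs] with t ht using dd_of_ne g ht
    have hs' : (s : ℂ) ≠ 0 := by exact_mod_cast hs
    have hcont : ContinuousAt (fun t : ℝ ↦ (g t - g 0) / t) s :=
      (hg.continuous.continuousAt.sub continuousAt_const).div Complex.continuous_ofReal.continuousAt hs'
    exact hcont.congr hev.symm

/-! ### The difference quotient of the potential along a curve -/

variable (c : ℝ → HPar)

/-- Coefficient functions along the curve: `ω²`, `ω`, `Λ`, `μ²`. [folklore] -/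
def cg1 (s : ℝ) : ℂ := (c s).1 ^ 2
/-- See `cg1`. [folklore] -/
def cg2 (s : ℝ) : ℂ := (c s).1
/-- See `cg1`. [folklore] -/
def cg3 (s : ℝ) : ℂ := (c s).2.1
/-- See `cg1`. [folklore] -/
def cg4 (s : ℝ) : ℂ := ((((c s).2.2 ^ 2 : ℝ)) : ℂ)

/-- The potential coefficient along the curve: `q_s = kgQc(·; toJ (c s))`. [folklore] -/
def cq (M a : ℝ) (m : ℤ) (c : ℝ → HPar) (s : ℝ) (r : ℝ) : ℂ := kgQc M a m (c s).1 (c s).2.1 ((((c s).2.2 ^ 2 : ℝ)) : ℂ) r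

/-- **The (extended) difference quotient of the potential**
`DQ s r = ((−(r²+a²)² + Δa²)·dd(ω²) + 4Mamr·dd(ω) + Δ·dd(Λ) + Δr²·dd(μ²))/Δ²`. [folklore] -/
def DQ (M a : ℝ) (m : ℤ) (c : ℝ → HPar) (s r : ℝ) : ℂ :=
  ((-((((r ^ 2 + a ^ 2) ^ 2 : ℝ)) : ℂ) + (delta M a r : ℂ) * ((a ^ 2 : ℝ) : ℂ)) * dd (cg1 c) s +
      (((4 * M * a * m * r : ℝ)) : ℂ) * dd (cg2 c) s + (delta M a r : ℂ) * dd (cg3 c) s +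
      (delta M a r : ℂ) * (((r ^ 2 : ℝ)) : ℂ) * dd (cg4 c) s) / (delta M a r : ℂ) ^ 2

/-- **`DQ` is the difference quotient of `q` off `s = 0`.** [folklore] -/
theorem DQ_of_ne (h : IsSubextremal M a) {s : ℝ} (hs : s ≠ 0) {r : ℝ} (hr : rPlus M a < r) :
    DQ M a m c s r = (cq M a m c s r - cq M a m c 0 r) / s := by
  have hΔ : (delta M a r : ℂ) ≠ 0 := by exact_mod_cast (delta_pos_of_gt h hr).ne'
  have hs' : (s : ℂ) ≠ 0 := by exact_mod_cast hs
  simp only [DQ, dd_of_ne _ hs, cq, cg1, cg2, cg3, cg4, kgQc, kgVc]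
  field_simp
  ring

/-- **Joint continuity of `DQ`** on `ℝ × (r₊, ∞)` for a `C¹` curve. [folklore] -/
theorem continuousOn_DQ (h : IsSubextremal M a) (hc : ContDiff ℝ 1 c) : ContinuousOn (fun x : ℝ × ℝ ↦ DQ M a m c x.1 x.2) (univ ×ˢ Ioi (rPlus M a)) := by
  have d1 : Continuous (dd (cg1 c)) := continuous_dd (by unfold cg1; fun_prop)
  have d2 : Continuous (dd (cg2 c)) := continuous_dd (by unfold cg2; fun_prop)
  have d3 : Continuous (dd (cg3 c)) := continuous_dd (by unfold cg3; fun_prop)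
  have d4 : Continuous (dd (cg4 c)) := continuous_dd (by unfold cg4; fun_prop)
  have hnum : Continuous fun x : ℝ × ℝ ↦
      (-((((x.2 ^ 2 + a ^ 2) ^ 2 : ℝ)) : ℂ) + (delta M a x.2 : ℂ) * ((a ^ 2 : ℝ) : ℂ)) * dd (cg1 c) x.1 +
        (((4 * M * a * m * x.2 : ℝ)) : ℂ) * dd (cg2 c) x.1 + (delta M a x.2 : ℂ) * dd (cg3 c) x.1 +
        (delta M a x.2 : ℂ) * (((x.2 ^ 2 : ℝ)) : ℂ) * dd (cg4 c) x.1 := by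
    have e1 : Continuous fun x : ℝ × ℝ ↦ dd (cg1 c) x.1 := d1.comp continuous_fst
    have e2 : Continuous fun x : ℝ × ℝ ↦ dd (cg2 c) x.1 := d2.comp continuous_fst
    have e3 : Continuous fun x : ℝ × ℝ ↦ dd (cg3 c) x.1 := d3.comp continuous_fst
    have e4 : Continuous fun x : ℝ × ℝ ↦ dd (cg4 c) x.1 := d4.comp continuous_fst
    unfold delta
    fun_prop
  have hden : Continuous fun x : ℝ × ℝ ↦ (delta M a x.2 : ℂ) ^ 2 := by unfold delta; fun_prop
  refine (hnum.continuousOn.div hden.continuousOn fun x hx ↦ pow_ne_zero 2 ?_)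
  exact_mod_cast (delta_pos_of_gt h hx.2).ne'

/-- **Uniform bound of `DQ` on `[−1, 1] × [R₁, ∞)`** (`R₁ ≥ max(1, 20(r₊+M))`). [folklore] -/
theorem exists_bound_DQ (h : IsSubextremal M a) (hc : ContDiff ℝ 1 c) {R₁ : ℝ} (hR : 20 * (rPlus M a + M) ≤ R₁) (hR1 : 1 ≤ R₁) :
    ∃ L : ℝ, ∀ s ∈ Icc (-1 : ℝ) 1, ∀ r, R₁ ≤ r → ‖DQ M a m c s r‖ ≤ L := by
  -- bounds of the divided differences on `[-1, 1]`
  have hb : ∀ g : ℝ → ℂ, ContDiff ℝ 1 g → ∃ G, ∀ s ∈ Icc (-1 : ℝ) 1, ‖dd g s‖ ≤ G := fun g hg ↦ by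
    obtain ⟨G, hG⟩ := isCompact_Icc.exists_bound_of_continuousOn ((continuous_dd hg).continuousOn (s := Icc (-1 : ℝ) 1))
    exact ⟨G, hG⟩
  obtain ⟨G1, hG1⟩ := hb (cg1 c) (by unfold cg1; fun_prop)
  obtain ⟨G2, hG2⟩ := hb (cg2 c) (by unfold cg2; fun_prop)
  obtain ⟨G3, hG3⟩ := hb (cg3 c) (by unfold cg3; fun_prop)
  obtain ⟨G4, hG4⟩ := hb (cg4 c) (by unfold cg4; fun_prop)
  have hM := h.pos
  have hG1n : 0 ≤ G1 := le_trans (norm_nonneg _) (hG1 0 (by norm_num))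
  have hG2n : 0 ≤ G2 := le_trans (norm_nonneg _) (hG2 0 (by norm_num))
  have hG3n : 0 ≤ G3 := le_trans (norm_nonneg _) (hG3 0 (by norm_num))
  have hG4n : 0 ≤ G4 := le_trans (norm_nonneg _) (hG4 0 (by norm_num))
  refine ⟨2 * G1 + 5 * M * |a| * |(m : ℝ)| * G2 + 2 * G3 + 2 * G4, fun s hs r hr ↦ ?_⟩
  have hr20 : 20 * (rPlus M a + M) ≤ r := hR.trans hr
  have hr1 : 1 ≤ r := hR1.trans hr
  obtain ⟨hΔ, hΔu, hrp, hr0⟩ := delta_ge_of_far h hr20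
  have hΔ0 : 0 < delta M a r := delta_pos_of_gt h hrp
  have hrp0 : 0 ≤ rPlus M a := le_trans h.rMinus_nonneg h.rMinus_lt_rPlus.le
  have ha : |a| < M := h
  have haM : a ^ 2 ≤ M ^ 2 := by nlinarith [abs_nonneg a, sq_abs a]
  have hMr : 20 * M ≤ r := by nlinarith
  -- the four `r`-dependent factors are bounded
  have f1 : ‖(-((((r ^ 2 + a ^ 2) ^ 2 : ℝ)) : ℂ) + (delta M a r : ℂ) * ((a ^ 2 : ℝ) : ℂ)) / (delta M a r : ℂ) ^ 2‖ ≤ 2 := by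
    rw [norm_div, norm_pow, Complex.norm_real, Real.norm_eq_abs, abs_of_pos hΔ0, div_le_iff₀ (by positivity)]
    have hn : ‖(-((((r ^ 2 + a ^ 2) ^ 2 : ℝ)) : ℂ) + (delta M a r : ℂ) * ((a ^ 2 : ℝ) : ℂ))‖ ≤ (r ^ 2 + a ^ 2) ^ 2 + delta M a r * a ^ 2 := by
      refine (norm_add_le _ _).trans ?_
      rw [norm_neg, Complex.norm_real, Real.norm_eq_abs, abs_of_nonneg (by positivity), norm_mul, Complex.norm_real,
        Complex.norm_real, Real.norm_eq_abs, Real.norm_eq_abs, abs_of_pos hΔ0, abs_of_nonneg (sq_nonneg a)]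
    refine hn.trans ?_
    have h400 : a ^ 2 ≤ r ^ 2 / 400 := by nlinarith
    have h5 : (r ^ 2 + a ^ 2) ^ 2 ≤ (r ^ 2 + r ^ 2 / 400) ^ 2 :=
      pow_le_pow_left₀ (by positivity) (by linarith) 2
    have h6 : delta M a r * a ^ 2 ≤ (r ^ 2 + r ^ 2 / 400) * (r ^ 2 / 400) :=
      mul_le_mul (by linarith) h400 (sq_nonneg a) (by positivity)
    have h7 : (9 / 10 * r ^ 2) ^ 2 ≤ delta M a r ^ 2 := pow_le_pow_left₀ (by positivity) hΔ 2
    nlinarith [h5, h6, h7]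
  have f2 : ‖(((4 * M * a * m * r : ℝ)) : ℂ) / (delta M a r : ℂ) ^ 2‖ ≤ 5 * M * |a| * |(m : ℝ)| := by
    rw [norm_div, norm_pow, Complex.norm_real, Complex.norm_real, Real.norm_eq_abs, Real.norm_eq_abs, abs_of_pos hΔ0,
      div_le_iff₀ (by positivity)]
    rw [show |4 * M * a * (m : ℝ) * r| = 4 * M * |a| * |(m : ℝ)| * r by
      rw [abs_mul, abs_mul, abs_mul, abs_mul, abs_of_pos hM, abs_of_pos hr0, abs_of_pos (by norm_num : (0 : ℝ) < 4)]]
    have hD2 : 81 / 100 * r ^ 4 ≤ delta M a r ^ 2 := by nlinarith [hΔ, sq_nonneg r]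
    have hr3 : r ≤ r ^ 4 := by
      have : (1 : ℝ) ≤ r ^ 3 := one_le_pow₀ hr1
      nlinarith
    have hpos : 0 ≤ M * |a| * |(m : ℝ)| := by positivity
    nlinarith
  have h9 : (9 : ℝ) / 10 ≤ delta M a r := by nlinarith [hΔ, hr1]
  have f3 : ‖(delta M a r : ℂ) / (delta M a r : ℂ) ^ 2‖ ≤ 2 := by
    rw [norm_div, norm_pow, Complex.norm_real, Real.norm_eq_abs, abs_of_pos hΔ0, div_le_iff₀ (by positivity)]
    nlinarith [mul_le_mul_of_nonneg_left h9 hΔ0.le]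
  have f4 : ‖(delta M a r : ℂ) * (((r ^ 2 : ℝ)) : ℂ) / (delta M a r : ℂ) ^ 2‖ ≤ 2 := by
    rw [norm_div, norm_pow, norm_mul, Complex.norm_real, Complex.norm_real, Real.norm_eq_abs, Real.norm_eq_abs, abs_of_pos hΔ0,
      abs_of_nonneg (sq_nonneg r), div_le_iff₀ (by positivity)]
    nlinarith [mul_le_mul_of_nonneg_left hΔ hΔ0.le]
  -- assemble
  have e : DQ M a m c s r =
      (-((((r ^ 2 + a ^ 2) ^ 2 : ℝ)) : ℂ) + (delta M a r : ℂ) * ((a ^ 2 : ℝ) : ℂ)) / (delta M a r : ℂ) ^ 2 * dd (cg1 c) s +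
        (((4 * M * a * m * r : ℝ)) : ℂ) / (delta M a r : ℂ) ^ 2 * dd (cg2 c) s + (delta M a r : ℂ) / (delta M a r : ℂ) ^ 2 * dd (cg3 c) s +
        (delta M a r : ℂ) * (((r ^ 2 : ℝ)) : ℂ) / (delta M a r : ℂ) ^ 2 * dd (cg4 c) s := by
    unfold DQ; ring
  rw [e]
  have t1 := norm_mul_le_of_le f1 (hG1 s hs)
  have t2 := norm_mul_le_of_le f2 (hG2 s hs)
  have t3 := norm_mul_le_of_le f3 (hG3 s hs)
  have t4 := norm_mul_le_of_le f4 (hG4 s hs)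
  calc _ ≤ ‖(-((((r ^ 2 + a ^ 2) ^ 2 : ℝ)) : ℂ) + (delta M a r : ℂ) * ((a ^ 2 : ℝ) : ℂ)) / (delta M a r : ℂ) ^ 2 * dd (cg1 c) s‖ +
        ‖(((4 * M * a * m * r : ℝ)) : ℂ) / (delta M a r : ℂ) ^ 2 * dd (cg2 c) s‖ + ‖(delta M a r : ℂ) / (delta M a r : ℂ) ^ 2 * dd (cg3 c) s‖ +
        ‖(delta M a r : ℂ) * (((r ^ 2 : ℝ)) : ℂ) / (delta M a r : ℂ) ^ 2 * dd (cg4 c) s‖ := norm_add₄_le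
    _ ≤ 2 * G1 + 5 * M * |a| * |(m : ℝ)| * G2 + 2 * G3 + 2 * G4 := by linarith

/-! ### The matching function along a curve and its derivative -/

/-- `y_s = yh (c s)`. [folklore] -/
def cA (h : IsSubextremal M a) (m : ℤ) (c : ℝ → HPar) (s r : ℝ) : ℂ := yh h m (c s) r
/-- `y_s' = yh' (c s)`. [folklore] -/
def cA' (h : IsSubextremal M a) (m : ℤ) (c : ℝ → HPar) (s r : ℝ) : ℂ := yh' h m (c s) r
/-- `y_{∞,s} = yInf (toJ (c s))`. [folklore] -/
def cB (m : ℤ) (h : IsSubextremal M a) (J : JD M a) (c : ℝ → HPar) (s r : ℝ) : ℂ := yI m h J (toJ (c s)) r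
/-- `y_{∞,s}'`. [folklore] -/
def cB' (m : ℤ) (h : IsSubextremal M a) (J : JD M a) (c : ℝ → HPar) (s r : ℝ) : ℂ := yI' m h J (toJ (c s)) r

/-- **The matching function** `𝒲(s) = W(y_s, y_{∞,s})(r_m)`, `r_m = R₁ + 1`. [cite: ShlapentokhRothman2014KleinGordon, §4.3] -/
def matchW (m : ℤ) (h : IsSubextremal M a) (J : JD M a) (c : ℝ → HPar) (s : ℝ) : ℂ :=
  wronskian (cA h m c s) (cA' h m c s) (cB m h J c s) (cB' m h J c s) (J.R₁ + 1)

/-- The `s`-derivative of the values `y_s(r)` at `s = 0`. [folklore] -/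
def dA (h : IsSubextremal M a) (m : ℤ) (c : ℝ → HPar) (r : ℝ) : ℂ := deriv (fun s ↦ cA h m c s r) 0
/-- The `s`-derivative of the values `y_s'(r)` at `s = 0`. [folklore] -/
def dA' (h : IsSubextremal M a) (m : ℤ) (c : ℝ → HPar) (r : ℝ) : ℂ := deriv (fun s ↦ cA' h m c s r) 0

/-- **The horizon-side boundary term** `β(r) = W(ẏ, y₀)(r) = ẏ(r) y₀'(r) − ẏ'(r) y₀(r)`. [folklore] -/
def betaW (h : IsSubextremal M a) (m : ℤ) (c : ℝ → HPar) (r : ℝ) : ℂ := dA h m c r * cA' h m c 0 r - dA' h m c r * cA h m c 0 r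

/-- **The setup of the derivative computation**: a `C¹` curve through the threshold point at
which the real mode is positive and decaying beyond `S₁ ≤ R₁ + 1`, Jost data with
`C_K‖jw p̂₀‖ < 1/2`, and the base matching constant `C_m`. [folklore] -/
structure MSetup (h : IsSubextremal M a) (m : ℤ) (J : JD M a) (c : ℝ → HPar) (lam μ : ℝ) (Cm : ℂ) (C k S₁ : ℝ) : Prop where
  hc : ContDiff ℝ 1 c
  hc0 : c 0 = (((kgOmega0 M a m : ℂ), (lam : ℂ), μ) : HPar)
  hpos : ∀ t ∈ Ioi (rPlus M a), 0 < radRe h m lam μ t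
  hk : 0 < k
  hS₁ : rPlus M a < S₁
  hS₁R : S₁ ≤ J.R₁ + 1
  hdec : ∀ t : ℝ, S₁ ≤ t → |radV h m lam μ t| ≤ C * Real.exp (-(k * t)) ∧ |radV' h m lam μ t| ≤ C * Real.exp (-(k * t))
  hsmall : jsmall m h J (pHat M a m lam μ) < 1 / 2
  hCm : EqOn (yI m h J (pHat M a m lam μ)) (fun t ↦ Cm * yh h m (((kgOmega0 M a m : ℂ), (lam : ℂ), μ) : HPar) t) (Ioi J.R₁)
  hCm' : EqOn (yI' m h J (pHat M a m lam μ)) (fun t ↦ Cm * yh' h m (((kgOmega0 M a m : ℂ), (lam : ℂ), μ) : HPar) t) (Ioi J.R₁)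

section Deriv

variable {h : IsSubextremal M a} {J : JD M a} {c : ℝ → HPar} {lam μ : ℝ} {Cm : ℂ} {C k S₁ : ℝ}

/-- `toJ (c 0) = p̂₀`. [folklore] -/
theorem MSetup.toJ_zero (S : MSetup h m J c lam μ Cm C k S₁) : toJ (c 0) = pHat M a m lam μ := by
  rw [S.hc0]; rfl

/-- The curve stays in `hzU` near `0`. [folklore] -/
theorem MSetup.eventually_mem_hzU (S : MSetup h m J c lam μ Cm C k S₁) : ∀ᶠ s in 𝓝 (0 : ℝ), c s ∈ hzU M a m := by
  have h0 : c 0 ∈ hzU M a m := by rw [S.hc0]; exact mem_hzU_omega0 h lam μ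
  exact S.hc.continuous.continuousAt.preimage_mem_nhds (isOpen_hzU.mem_nhds h0)

/-- The Jost smallness stays below `1/2` near `0`. [folklore] -/
theorem MSetup.eventually_small (S : MSetup h m J c lam μ Cm C k S₁) : ∀ᶠ s in 𝓝 (0 : ℝ), jsmall m h J (toJ (c s)) < 1 / 2 := by
  have hcont : Continuous fun s ↦ jsmall m h J (toJ (c s)) := (continuous_jsmall (m := m) h J).comp ((contDiff_toJ (n := 0)).continuous.comp S.hc.continuous)
  have h0 : jsmall m h J (toJ (c 0)) < 1 / 2 := by rw [S.toJ_zero]; exact S.hsmall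
  exact hcont.continuousAt.eventually_lt continuousAt_const h0

/-- `y_s` solves `y'' = q_s y` on `(r₊, ∞)`. [folklore] -/
theorem isSol2_cA (s : ℝ) : IsSol2 (cq M a m c s) (cA h m c s) (cA' h m c s) (Ioi (rPlus M a)) := by
  unfold cq cA cA'
  exact isSol2_yh h (c s)

/-- `y_{∞,s}` solves `y'' = q_s y` on `(R₁, ∞)` when the Jost family converges. [folklore] -/
theorem isSol2_cB {s : ℝ} (hs : jsmall m h J (toJ (c s)) < 1) : IsSol2 (cq M a m c s) (cB m h J c s) (cB' m h J c s) (Ioi J.R₁) := by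
  have e1 : (toJ (c s)).1 = (c s).1 := rfl
  have e2 : (toJ (c s)).2.1 = (c s).2.1 := rfl
  have e3 : (toJ (c s)).2.2 = ((((c s).2.2 ^ 2 : ℝ)) : ℂ) := rfl
  have h0 := isSol2_yInf m h J.hR J.hR1 J.h₁ J.hγ hs
  rw [e1, e2, e3] at h0
  unfold cq cB cB' yI yI'
  exact h0

/-- `q_s` is continuous on `(r₊, ∞)`. [folklore] -/
theorem continuousOn_cq (h : IsSubextremal M a) (s : ℝ) : ContinuousOn (cq M a m c s) (Ioi (rPlus M a)) := continuousOn_kgQc h _ _ _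

/-- The values `s ↦ (y_s(r), y_s'(r))` are `C¹` at `0` (`r > r₊`). [folklore] -/
theorem MSetup.contDiffAt_cA (S : MSetup h m J c lam μ Cm C k S₁) {r : ℝ} (hr : rPlus M a < r) :
    ContDiffAt ℝ 1 (fun s ↦ cA h m c s r) 0 ∧ ContDiffAt ℝ 1 (fun s ↦ cA' h m c s r) 0 := by
  have h0 : c 0 ∈ hzU M a m := by rw [S.hc0]; exact mem_hzU_omega0 h lam μ
  obtain ⟨h1, h2⟩ := contDiffOn_yh_apply (m := m) h hr (n := 1)
  have hn : (isOpen_hzU (M := M) (a := a) (m := m)).mem_nhds h0 = (isOpen_hzU (M := M) (a := a) (m := m)).mem_nhds h0 := rfl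
  exact ⟨(h1.contDiffAt (isOpen_hzU.mem_nhds h0)).comp 0 S.hc.contDiffAt, (h2.contDiffAt (isOpen_hzU.mem_nhds h0)).comp 0 S.hc.contDiffAt⟩

/-- The values `s ↦ (y_{∞,s}(r), y_{∞,s}'(r))` are `C¹` at `0`. [folklore] -/
theorem MSetup.contDiffAt_cB (S : MSetup h m J c lam μ Cm C k S₁) (r : ℝ) :
    ContDiffAt ℝ 1 (fun s ↦ cB m h J c s r) 0 ∧ ContDiffAt ℝ 1 (fun s ↦ cB' m h J c s r) 0 := by
  have hw : jostKconst J.γ₀ J.γ₁ * ‖jw m h J.γ₀ J.hR J.hR1 (toJ (c 0))‖ < 1 := by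
    have := S.hsmall; rw [← S.toJ_zero] at this; unfold jsmall at this; linarith
  have h1 := ((contDiffAt_yInf m h J.hR J.hR1 J.h₁ J.hγ hw r (n := 1)).restrict_scalars ℝ).comp 0 (contDiff_toJ.contDiffAt.comp 0 S.hc.contDiffAt)
  have h2 := ((contDiffAt_yInf' m h J.hR J.hR1 J.h₁ J.hγ hw r (n := 1)).restrict_scalars ℝ).comp 0 (contDiff_toJ.contDiffAt.comp 0 S.hc.contDiffAt)
  exact ⟨h1, h2⟩

/-- Joint continuity of `(s, r) ↦ y_s(r)` at points with `c s ∈ hzU`, `r > r₊`. [folklore] -/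
theorem MSetup.continuousAt_cA_joint (S : MSetup h m J c lam μ Cm C k S₁) {x : ℝ × ℝ} (hs : c x.1 ∈ hzU M a m) (hr : rPlus M a < x.2) :
    ContinuousAt (fun y : ℝ × ℝ ↦ cA h m c y.1 y.2) x := by
  have hj := (contDiffAt_hPair_joint (m := m) h (x := (c x.1, x.2)) hs hr (n := 0)).continuousAt
  have hin : ContinuousAt (fun y : ℝ × ℝ ↦ ((c y.1, y.2) : HPar × ℝ)) x :=
    ((S.hc.continuous.comp continuous_fst).prodMk continuous_snd).continuousAt
  have hcomp := ContinuousAt.comp (f := fun y : ℝ × ℝ ↦ ((c y.1, y.2) : HPar × ℝ)) hj hin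
  have h1 : ContinuousAt (fun y : ℝ × ℝ ↦ (hPair h m (c y.1)).1 y.2) x := continuousAt_fst.comp hcomp
  have hsq : ContinuousAt (fun y : ℝ × ℝ ↦ ((Real.sqrt (delta M a y.2) : ℝ) : ℂ)) x := by
    have : Continuous fun y : ℝ × ℝ ↦ ((Real.sqrt (delta M a y.2) : ℝ) : ℂ) := by unfold delta; fun_prop
    exact this.continuousAt
  unfold cA yh
  exact hsq.mul h1

/-- **The value of the matching function at `0` is `0`.** [folklore] -/
theorem MSetup.matchW_zero (S : MSetup h m J c lam μ Cm C k S₁) : matchW m h J c 0 = 0 := by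
  have hr : J.R₁ + 1 ∈ Ioi J.R₁ := by simp
  have e1 : yI m h J (pHat M a m lam μ) (J.R₁ + 1) = Cm * yh h m (((kgOmega0 M a m : ℂ), (lam : ℂ), μ) : HPar) (J.R₁ + 1) := S.hCm hr
  have e2 : yI' m h J (pHat M a m lam μ) (J.R₁ + 1) = Cm * yh' h m (((kgOmega0 M a m : ℂ), (lam : ℂ), μ) : HPar) (J.R₁ + 1) := S.hCm' hr
  have et : toJ (c 0) = pHat M a m lam μ := S.toJ_zero
  simp only [matchW, wronskian, cB, cB', cA, cA']
  rw [et, e1, e2, S.hc0]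
  ring

/-- **The derivative of the matching function** at `s = 0`: for every `r_h ∈ (r₊, r_m)`,
`𝒲'(0) = C_m (β(r_h) − ∫_{r_h}^{r_m} q̇ y₀²) − C_m ∫_{(r_m, ∞)} q̇ y₀²` (`q̇ = DQ 0`, `y₀ = y_{c 0}`,
`r_m = R₁ + 1`). [cite: ShlapentokhRothman2014KleinGordon, Lemma 4.5] -/
theorem MSetup.hasDerivAt_matchW (S : MSetup h m J c lam μ Cm C k S₁) {rh : ℝ} (hrh : rh ∈ Ioo (rPlus M a) (J.R₁ + 1)) :
    HasDerivAt (matchW m h J c)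
      (Cm * (betaW h m c rh - ∫ r in rh..(J.R₁ + 1), DQ M a m c 0 r * cA h m c 0 r * cA h m c 0 r) -
        Cm * ∫ r in Ioi (J.R₁ + 1), DQ M a m c 0 r * cA h m c 0 r * cA h m c 0 r) 0 := by
  set rm := J.R₁ + 1 with hrm
  have hRr : rPlus M a < J.R₁ := (delta_ge_of_far h J.hR).2.2.1
  have hrmp : rPlus M a < rm := by rw [hrm]; linarith
  have hrmR : J.R₁ < rm := by rw [hrm]; linarith
  set p₀ : HPar := ((kgOmega0 M a m : ℂ), (lam : ℂ), μ) with hp₀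
  have hc0 := S.hc0
  -- neighbourhoods of `0`
  have hU := S.eventually_mem_hzU
  have hJs := S.eventually_small
  have hA0contr : ContinuousOn (cA h m c 0) (Ioi (rPlus M a)) := (isSol2_cA (h := h) (m := m) (c := c) 0).continuousOn.1
  have hAcontr : ∀ s, ContinuousOn (cA h m c s) (Ioi (rPlus M a)) := fun s ↦ (isSol2_cA (h := h) (m := m) (c := c) s).continuousOn.1
  have hqcontr : ∀ s, ContinuousOn (cq M a m c s) (Ioi (rPlus M a)) := fun s ↦ continuousOn_cq (m := m) (c := c) h s
  have hDcontr : ∀ s, ContinuousOn (DQ M a m c s) (Ioi (rPlus M a)) := fun s ↦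
    (continuousOn_DQ (m := m) c h S.hc).comp (f := fun r : ℝ ↦ ((s, r) : ℝ × ℝ)) (Continuous.continuousOn (by fun_prop))
      fun r hr ↦ ⟨trivial, hr⟩
  -- decay data of `y₀ = cA h m c 0` on `[rm, ∞)` and beyond `S₁`
  have hdec1 := yh_base_decay (m := m) h lam μ S.hpos S.hS₁ S.hdec
  have hA0dec : ∀ t, S₁ ≤ t → ‖cA h m c 0 t‖ ≤ ‖radCst M a m‖ * C * Real.exp (-(k * t)) ∧ ‖cA' h m c 0 t‖ ≤ ‖radCst M a m‖ * C * Real.exp (-(k * t)) := by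
    intro t ht; simp only [cA, cA', hc0]; exact hdec1 t ht
  ------------------------------------------------------------------
  -- Step 1: the base relations `cB m h J c 0 = Cm cA h m c 0` on `(R₁, ∞)`
  ------------------------------------------------------------------
  have hB0 : EqOn (cB m h J c 0) (fun t ↦ Cm * cA h m c 0 t) (Ioi J.R₁) := by
    intro t ht; simp only [cB, cA, hc0]; exact S.hCm ht
  have hB0' : EqOn (cB' m h J c 0) (fun t ↦ Cm * cA' h m c 0 t) (Ioi J.R₁) := by
    intro t ht; simp only [cB', cA', hc0]; exact S.hCm' ht
  ------------------------------------------------------------------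
  -- Step 2: the decomposition of `𝒲(s)`
  ------------------------------------------------------------------
  have hdecomp : ∀ s, matchW m h J c s = Cm * wronskian (cA h m c s) (cA' h m c s) (cA h m c 0) (cA' h m c 0) rm + wronskian (cA h m c 0) (cA' h m c 0) (cB m h J c s) (cB' m h J c s) rm +
      wronskian (cA h m c s - cA h m c 0) (cA' h m c s - cA' h m c 0) (cB m h J c s - cB m h J c 0) (cB' m h J c s - cB' m h J c 0) rm := by
    intro s
    have e1 := hB0 hrmR
    have e2 := hB0' hrmR
    simp only [matchW, wronskian, Pi.sub_apply]
    simp only at e1 e2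
    rw [e1, e2]; ring
  ------------------------------------------------------------------
  -- Step 3: the horizon-side term
  ------------------------------------------------------------------
  -- (3a) the boundary slope at `rh`
  have h3a : Tendsto (fun s ↦ wronskian (cA h m c s) (cA' h m c s) (cA h m c 0) (cA' h m c 0) rh / s) (𝓝[≠] 0) (𝓝 (betaW h m c rh)) := by
    obtain ⟨d1, d2⟩ := S.contDiffAt_cA hrh.1
    have e1 : HasDerivAt (fun s ↦ cA h m c s rh) (dA h m c rh) 0 := (d1.differentiableAt one_ne_zero).hasDerivAt
    have e2 : HasDerivAt (fun s ↦ cA' h m c s rh) (dA' h m c rh) 0 := (d2.differentiableAt one_ne_zero).hasDerivAt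
    have hφ : HasDerivAt (fun s ↦ wronskian (cA h m c s) (cA' h m c s) (cA h m c 0) (cA' h m c 0) rh) (dA h m c rh * cA' h m c 0 rh - dA' h m c rh * cA h m c 0 rh) 0 := by
      have h' := (e1.mul_const (cA' h m c 0 rh)).sub (e2.mul_const (cA h m c 0 rh))
      exact h'.congr_of_eventuallyEq (Eventually.of_forall fun s ↦ by simp only [Pi.sub_apply, wronskian])
    have hsl := hasDerivAt_iff_tendsto_slope.1 hφ
    have h0 : wronskian (cA h m c 0) (cA' h m c 0) (cA h m c 0) (cA' h m c 0) rh = 0 := wronskian_self _ _ _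
    refine (hsl.congr' ?_).trans ?_
    · filter_upwards [self_mem_nhdsWithin] with s hs
      rw [slope_def_module, h0, sub_zero]; simp [div_eq_inv_mul]
    · simp only [betaW]; exact le_rfl
  -- (3b) continuity at `0` of the compact parametric integral
  have h3b : ContinuousAt (fun s ↦ ∫ r in rh..rm, DQ M a m c s r * cA h m c s r * cA h m c 0 r) 0 := by
    -- a compact neighbourhood `[-δ, δ]` of `0` on which `c s ∈ hzU`
    obtain ⟨δ, hδ, hδU⟩ : ∃ δ > (0 : ℝ), ∀ s, |s| ≤ δ → c s ∈ hzU M a m := by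
      obtain ⟨ε, hε, hball⟩ := Metric.eventually_nhds_iff.1 hU
      exact ⟨ε / 2, by positivity, fun s hs ↦ hball (by rw [Real.dist_eq, sub_zero]; linarith)⟩
    -- joint continuity of the integrand on `[-δ, δ] × [rh, rm]`
    have hF : ContinuousOn (fun y : ℝ × ℝ ↦ DQ M a m c y.1 y.2 * cA h m c y.1 y.2 * cA h m c 0 y.2) (Icc (-δ) δ ×ˢ Icc rh rm) := by
      intro y hy
      have hy1 : c y.1 ∈ hzU M a m := hδU y.1 (abs_le.2 hy.1)
      have hy2 : rPlus M a < y.2 := lt_of_lt_of_le hrh.1 hy.2.1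
      have hDc : ContinuousAt (fun y : ℝ × ℝ ↦ DQ M a m c y.1 y.2) y :=
        (continuousOn_DQ (m := m) c h S.hc).continuousAt ((isOpen_univ.prod isOpen_Ioi).mem_nhds ⟨trivial, hy2⟩)
      have hAc : ContinuousAt (fun y : ℝ × ℝ ↦ cA h m c y.1 y.2) y := S.continuousAt_cA_joint hy1 hy2
      have hA0c : ContinuousAt (fun y : ℝ × ℝ ↦ cA h m c 0 y.2) y := (hA0contr.continuousAt (Ioi_mem_nhds hy2)).comp continuousAt_snd
      exact ((hDc.mul hAc).mul hA0c).continuousWithinAt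
    obtain ⟨K, hK⟩ := (isCompact_Icc.prod isCompact_Icc).exists_bound_of_continuousOn hF
    refine intervalIntegral.continuousAt_of_dominated_interval (bound := fun _ ↦ K) ?_ ?_ intervalIntegrable_const ?_
    · refine Eventually.of_forall fun s ↦ ?_
      refine ContinuousOn.aestronglyMeasurable ?_ measurableSet_uIoc
      rw [uIoc_of_le hrh.2.le]
      have hsub' : Ioc rh rm ⊆ Ioi (rPlus M a) := fun r hr ↦ lt_of_lt_of_le hrh.1 hr.1.le
      exact ((((hDcontr s).mul (hAcontr s)).mul hA0contr).mono hsub')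
    · filter_upwards [Metric.ball_mem_nhds (0 : ℝ) hδ] with s hs
      have hs' : |s| ≤ δ := by rw [Metric.mem_ball, Real.dist_eq, sub_zero] at hs; exact hs.le
      refine Eventually.of_forall fun r hr ↦ ?_
      rw [uIoc_of_le hrh.2.le] at hr
      exact hK (s, r) ⟨abs_le.1 hs', hr.1.le, hr.2⟩
    · refine Eventually.of_forall fun r hr ↦ ?_
      rw [uIoc_of_le hrh.2.le] at hr
      have hin : ContinuousAt (fun s : ℝ ↦ ((s, r) : ℝ × ℝ)) 0 := (continuous_id.prodMk continuous_const).continuousAt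
      have hy : ((0 : ℝ), r) ∈ Icc (-δ) δ ×ˢ Icc rh rm := ⟨⟨by linarith, hδ.le⟩, hr.1.le, hr.2⟩
      have hint : Icc (-δ) δ ×ˢ Icc rh rm ∈ 𝓝[Icc (-δ) δ ×ˢ Icc rh rm] ((0 : ℝ), r) := self_mem_nhdsWithin
      have hc' := hF (0, r) hy
      -- upgrade to `ContinuousAt` using the open neighbourhood in the first variable
      have hopen : ContinuousAt (fun y : ℝ × ℝ ↦ DQ M a m c y.1 y.2 * cA h m c y.1 y.2 * cA h m c 0 y.2) (0, r) := by
        have hy1 : c 0 ∈ hzU M a m := hδU 0 (by simp [hδ.le])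
        have hy2 : rPlus M a < r := lt_of_lt_of_le hrh.1 hr.1.le
        have hDc : ContinuousAt (fun y : ℝ × ℝ ↦ DQ M a m c y.1 y.2) (0, r) :=
          (continuousOn_DQ (m := m) c h S.hc).continuousAt ((isOpen_univ.prod isOpen_Ioi).mem_nhds ⟨trivial, hy2⟩)
        have hAc : ContinuousAt (fun y : ℝ × ℝ ↦ cA h m c y.1 y.2) (0, r) := S.continuousAt_cA_joint (x := (0, r)) hy1 hy2
        have hA0c : ContinuousAt (fun y : ℝ × ℝ ↦ cA h m c 0 y.2) (0, r) := (hA0contr.continuousAt (Ioi_mem_nhds hy2)).comp continuousAt_snd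
        exact (hDc.mul hAc).mul hA0c
      exact ContinuousAt.comp (f := fun s : ℝ ↦ ((s, r) : ℝ × ℝ)) hopen hin
  -- (3c) the representation of `W(cA h m c s, cA h m c 0)(rm)` for `s ≠ 0`
  have h3c : ∀ s, s ≠ 0 → wronskian (cA h m c s) (cA' h m c s) (cA h m c 0) (cA' h m c 0) rm / s =
      wronskian (cA h m c s) (cA' h m c s) (cA h m c 0) (cA' h m c 0) rh / s - ∫ r in rh..rm, DQ M a m c s r * cA h m c s r * cA h m c 0 r := by
    intro s hs
    have hsub : Icc rh rm ⊆ Ioi (rPlus M a) := fun r hr ↦ lt_of_lt_of_le hrh.1 hr.1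
    have hW := wronskian_sub_eq_integral (isSol2_cA (h := h) (m := m) (c := c) s) (isSol2_cA (h := h) (m := m) (c := c) 0)
      (continuousOn_cq (m := m) (c := c) h s) (continuousOn_cq (m := m) (c := c) h 0) hrh.2.le hsub
    have hs' : (s : ℂ) ≠ 0 := by exact_mod_cast hs
    have hI : ∫ r in rh..rm, DQ M a m c s r * cA h m c s r * cA h m c 0 r = (1 / s) * ∫ r in rh..rm, (cq M a m c s r - cq M a m c 0 r) * cA h m c s r * cA h m c 0 r := by
      rw [← intervalIntegral.integral_const_mul]
      refine intervalIntegral.integral_congr fun r hr ↦ ?_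
      rw [uIcc_of_le hrh.2.le] at hr
      rw [DQ_of_ne c h hs (lt_of_lt_of_le hrh.1 hr.1)]
      field_simp
    rw [hI]
    have hW' := sub_eq_iff_eq_add.1 hW
    rw [hW']
    have hneg : (∫ t in rh..rm, (cq M a m c 0 t - cq M a m c s t) * cA h m c s t * cA h m c 0 t) =
        -∫ t in rh..rm, (cq M a m c s t - cq M a m c 0 t) * cA h m c s t * cA h m c 0 t := by
      rw [← intervalIntegral.integral_neg]
      refine intervalIntegral.integral_congr fun t _ ↦ ?_
      ring
    rw [hneg]
    field_simp
    ring
  have h3 : Tendsto (fun s ↦ wronskian (cA h m c s) (cA' h m c s) (cA h m c 0) (cA' h m c 0) rm / s) (𝓝[≠] 0)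
      (𝓝 (betaW h m c rh - ∫ r in rh..rm, DQ M a m c 0 r * cA h m c 0 r * cA h m c 0 r)) := by
    have hlim := h3a.sub (h3b.tendsto.mono_left nhdsWithin_le_nhds)
    refine hlim.congr' ?_
    filter_upwards [self_mem_nhdsWithin] with s hs using (h3c s hs).symm
  ------------------------------------------------------------------
  -- Step 4: the tail term
  ------------------------------------------------------------------
  obtain ⟨L, hL⟩ := exists_bound_DQ (m := m) c h S.hc J.hR J.hR1
  -- uniform bounds of the Jost family near `s = 0`
  set nw : ℝ → ℝ := fun s ↦ ‖jw m h J.γ₀ J.hR J.hR1 (toJ (c s))‖ with hnw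
  have hnwc : Continuous nw := (contDiff_jw m h J.γ₀ J.hR J.hR1 (n := 0)).continuous.norm.comp ((contDiff_toJ (n := 0)).continuous.comp S.hc.continuous)
  have hnw1 : ∀ᶠ s in 𝓝 (0 : ℝ), nw s < nw 0 + 1 := hnwc.continuousAt.eventually_lt continuousAt_const (by linarith)
  set Kb : ℝ := max 2 (‖J.γ₀‖ + 1 / 2 * (1 / (J.γ₀.re - J.γ₁) + 1 / (J.γ₀.re + J.γ₁)) * ((nw 0 + 1) * 2)) with hKb
  have hKb2 : (2 : ℝ) ≤ Kb := le_max_left _ _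
  have hKb0 : 0 < Kb := by linarith
  have hBbd : ∀ᶠ s in 𝓝 (0 : ℝ), jsmall m h J (toJ (c s)) < 1 ∧ ∀ r, J.R₁ ≤ r →
      ‖cB m h J c s r‖ ≤ Kb * Real.exp (-(J.γ₁ * (r - J.R₁))) ∧ ‖cB' m h J c s r‖ ≤ Kb * Real.exp (-(J.γ₁ * (r - J.R₁))) := by
    filter_upwards [hJs, hnw1] with s hs hn
    have hw : jostKconst J.γ₀ J.γ₁ * ‖jw m h J.γ₀ J.hR J.hR1 (toJ (c s))‖ < 1 := by unfold jsmall at hs; linarith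
    refine ⟨by unfold jsmall; exact hw, fun r hr ↦ ?_⟩
    have hfrac : 1 / (1 - jostKconst J.γ₀ J.γ₁ * ‖jw m h J.γ₀ J.hR J.hR1 (toJ (c s))‖) ≤ 2 := by
      unfold jsmall at hs
      rw [div_le_iff₀ (by linarith)]; linarith
    have hfrac0 : 0 ≤ 1 / (1 - jostKconst J.γ₀ J.γ₁ * ‖jw m h J.γ₀ J.hR J.hR1 (toJ (c s))‖) := by
      unfold jsmall at hs; exact div_nonneg zero_le_one (by linarith)
    have hn1 := norm_yInf_le m h J.hR J.hR1 J.h₁ J.hγ hw r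
    have hn2 := norm_yInf'_le m h J.hR J.hR1 J.h₁ J.hγ hw hr
    have hE := Real.exp_pos (-(J.γ₁ * (r - J.R₁)))
    have hpos1 : 0 ≤ 1 / (J.γ₀.re - J.γ₁) + 1 / (J.γ₀.re + J.γ₁) := by
      have h1 : 0 < J.γ₀.re - J.γ₁ := by linarith [J.hγ]
      have h2 : 0 < J.γ₀.re + J.γ₁ := by linarith [J.hγ, J.h₁]
      positivity
    have hprod : ‖jw m h J.γ₀ J.hR J.hR1 (toJ (c s))‖ * (1 / (1 - jostKconst J.γ₀ J.γ₁ * ‖jw m h J.γ₀ J.hR J.hR1 (toJ (c s))‖)) ≤ (nw 0 + 1) * 2 :=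
      mul_le_mul (by simp only [hnw] at hn; exact hn.le) hfrac hfrac0 (by linarith [norm_nonneg (jw m h J.γ₀ J.hR J.hR1 (toJ (c 0)))])
    constructor
    · calc ‖cB m h J c s r‖ ≤ _ := hn1
        _ ≤ Real.exp (-(J.γ₁ * (r - J.R₁))) * Kb := mul_le_mul_of_nonneg_left (hfrac.trans hKb2) hE.le
        _ = Kb * Real.exp (-(J.γ₁ * (r - J.R₁))) := mul_comm _ _
    · calc ‖cB' m h J c s r‖ ≤ _ := hn2
        _ ≤ Real.exp (-(J.γ₁ * (r - J.R₁))) * Kb := by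
            refine mul_le_mul_of_nonneg_left (le_trans ?_ (le_max_right _ _)) hE.le
            gcongr
        _ = Kb * Real.exp (-(J.γ₁ * (r - J.R₁))) := mul_comm _ _
  -- continuity of `cB m h J c s r` in `s` at `0`, and of `cB m h J c s` in `r` on `(R₁, ∞)`
  have hBcont0 : ∀ r, ContinuousAt (fun s ↦ cB m h J c s r) 0 := fun r ↦ (S.contDiffAt_cB r).1.continuousAt
  have hBcontr : ∀ s, jsmall m h J (toJ (c s)) < 1 → ContinuousOn (cB m h J c s) (Ioi J.R₁) := fun s hs ↦ (isSol2_cB (m := m) hs).continuousOn.1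
  -- the dominating function on `(rm, ∞)`
  set bnd : ℝ → ℝ := fun r ↦ L * (‖radCst M a m‖ * C * Real.exp (-(k * r))) * Kb with hbnd
  have hbnd_int : IntegrableOn bnd (Ioi rm) := by
    have hI : IntegrableOn (fun x ↦ L * (‖radCst M a m‖ * C) * Real.exp (-k * x) * Kb) (Ioi rm) :=
      ((exp_neg_integrableOn_Ioi rm S.hk).const_mul (L * (‖radCst M a m‖ * C))).mul_const Kb
    refine hI.congr_fun (fun r _ ↦ ?_) measurableSet_Ioi
    simp only [hbnd, neg_mul]
    ring
  have hL0 : 0 ≤ L := le_trans (norm_nonneg _) (hL 0 (by norm_num) J.R₁ le_rfl)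
  -- pointwise domination `‖DQ M a m c s r * cA h m c 0 r * cB m h J c s r‖ ≤ bnd r` for `|s| ≤ 1`, small, `r > rm`
  have hdom : ∀ s, |s| ≤ 1 → (∀ r, J.R₁ ≤ r → ‖cB m h J c s r‖ ≤ Kb * Real.exp (-(J.γ₁ * (r - J.R₁)))) →
      ∀ r, rm < r → ‖DQ M a m c s r * cA h m c 0 r * cB m h J c s r‖ ≤ bnd r := by
    intro s hs hBs r hr
    have hrR : J.R₁ ≤ r := by linarith
    have hrS : S₁ ≤ r := by linarith [S.hS₁R]
    have h1 : ‖DQ M a m c s r‖ ≤ L := hL s (abs_le.1 hs) r hrR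
    have h2 : ‖cA h m c 0 r‖ ≤ ‖radCst M a m‖ * C * Real.exp (-(k * r)) := (hA0dec r hrS).1
    have h3 : ‖cB m h J c s r‖ ≤ Kb := by
      refine (hBs r hrR).trans ?_
      have : Real.exp (-(J.γ₁ * (r - J.R₁))) ≤ 1 := by
        rw [Real.exp_le_one_iff]; nlinarith [J.h₁]
      nlinarith
    rw [norm_mul, norm_mul, hbnd]
    have hA0n : 0 ≤ ‖radCst M a m‖ * C * Real.exp (-(k * r)) := le_trans (norm_nonneg _) h2
    exact mul_le_mul (mul_le_mul h1 h2 (norm_nonneg _) hL0) h3 (norm_nonneg _) (mul_nonneg hL0 hA0n)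
  -- (4a) the representation for `s ≠ 0`
  have h4a : ∀ᶠ s in 𝓝[≠] (0 : ℝ), wronskian (cA h m c 0) (cA' h m c 0) (cB m h J c s) (cB' m h J c s) rm / s = -∫ r in Ioi rm, DQ M a m c s r * cA h m c 0 r * cB m h J c s r := by
    have hball : ∀ᶠ s in 𝓝 (0 : ℝ), |s| ≤ 1 := by
      filter_upwards [Metric.ball_mem_nhds (0 : ℝ) one_pos] with s hs
      rw [Metric.mem_ball, Real.dist_eq, sub_zero] at hs; exact hs.le
    have hev := (hBbd.and hball)
    rw [eventually_nhdsWithin_iff]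
    filter_upwards [hev] with s hs12 hs0
    obtain ⟨⟨hs1, hBs⟩, hs2⟩ := hs12
    have hs0' : (s : ℂ) ≠ 0 := by exact_mod_cast hs0
    -- integrability of `(cq M a m c s − cq M a m c 0) A0 cB m h J c s` on `(rm, ∞)`
    have hmeas : AEStronglyMeasurable (fun r ↦ (cq M a m c s r - cq M a m c 0 r) * cA h m c 0 r * cB m h J c s r) (volume.restrict (Ioi rm)) := by
      refine ContinuousOn.aestronglyMeasurable ?_ measurableSet_Ioi
      exact ((((hqcontr s).mono (Ioi_subset_Ioi hrmp.le)).sub ((hqcontr 0).mono (Ioi_subset_Ioi hrmp.le))).mul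
        (hA0contr.mono (Ioi_subset_Ioi hrmp.le))).mul ((hBcontr s hs1).mono (Ioi_subset_Ioi hrmR.le))
    have hint : IntegrableOn (fun r ↦ (cq M a m c s r - cq M a m c 0 r) * cA h m c 0 r * cB m h J c s r) (Ioi rm) := by
      refine Integrable.mono' (hbnd_int.const_mul |s|) hmeas ?_
      refine (ae_restrict_mem measurableSet_Ioi).mono fun r hr ↦ ?_
      have hrp : rPlus M a < r := hrmp.trans hr
      have e : (cq M a m c s r - cq M a m c 0 r) * cA h m c 0 r * cB m h J c s r = (s : ℂ) * (DQ M a m c s r * cA h m c 0 r * cB m h J c s r) := by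
        rw [DQ_of_ne c h hs0 hrp]; field_simp
      rw [e, norm_mul, Complex.norm_real, Real.norm_eq_abs]
      exact mul_le_mul_of_nonneg_left (hdom s hs2 (fun r hr ↦ (hBs r hr).1) r hr) (abs_nonneg s)
    -- the Wronskian tends to zero
    have hlim : Tendsto (wronskian (cA h m c 0) (cA' h m c 0) (cB m h J c s) (cB' m h J c s)) atTop (𝓝 0) := by
      refine tendsto_wronskian_zero_of_decay (κ := k) (κ' := J.γ₁) (C := ‖radCst M a m‖ * C) (C' := Kb * Real.exp (J.γ₁ * J.R₁))
        (T := max S₁ J.R₁) (by linarith [S.hk, J.h₁]) (fun t ht ↦ hA0dec t (le_trans (le_max_left _ _) ht)) (fun t ht ↦ ?_)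
      have htR : J.R₁ ≤ t := le_trans (le_max_right _ _) ht
      have e : Real.exp (-(J.γ₁ * (t - J.R₁))) = Real.exp (J.γ₁ * J.R₁) * Real.exp (-(J.γ₁ * t)) := by
        rw [← Real.exp_add]; congr 1; ring
      obtain ⟨b1, b2⟩ := hBs t htR
      rw [e] at b1 b2
      constructor <;> nlinarith [b1, b2, Real.exp_pos (J.γ₁ * J.R₁), Real.exp_pos (-(J.γ₁ * t))]
    have hW := wronskian_eq_neg_integral_Ioi ((isSol2_cA (h := h) (m := m) (c := c) 0).mono (Ioi_subset_Ioi hRr.le))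
      (isSol2_cB (m := m) hs1) (fun r hr ↦ lt_of_lt_of_le hrmR hr) hint hlim
    rw [hW]
    have hI : ∫ r in Ioi rm, DQ M a m c s r * cA h m c 0 r * cB m h J c s r =
        (1 / (s : ℂ)) * ∫ r in Ioi rm, (cq M a m c s r - cq M a m c 0 r) * cA h m c 0 r * cB m h J c s r := by
      rw [← integral_const_mul]
      refine setIntegral_congr_fun measurableSet_Ioi fun r hr ↦ ?_
      rw [DQ_of_ne c h hs0 (hrmp.trans hr)]
      field_simp
    rw [hI]
    field_simp
  -- (4b) continuity at `0` of the tail integral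
  have h4b : ContinuousAt (fun s ↦ ∫ r in Ioi rm, DQ M a m c s r * cA h m c 0 r * cB m h J c s r) 0 := by
    have hball : ∀ᶠ s in 𝓝 (0 : ℝ), |s| ≤ 1 := by
      filter_upwards [Metric.ball_mem_nhds (0 : ℝ) one_pos] with s hs
      rw [Metric.mem_ball, Real.dist_eq, sub_zero] at hs; exact hs.le
    refine continuousAt_of_dominated (μ := volume.restrict (Ioi rm)) (bound := bnd) ?_ ?_ hbnd_int ?_
    · filter_upwards [hBbd] with s hs12
      obtain ⟨hs1, -⟩ := hs12
      refine ContinuousOn.aestronglyMeasurable ?_ measurableSet_Ioi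
      exact (((hDcontr s).mono (Ioi_subset_Ioi hrmp.le)).mul (hA0contr.mono (Ioi_subset_Ioi hrmp.le))).mul
        ((hBcontr s hs1).mono (Ioi_subset_Ioi hrmR.le))
    · filter_upwards [hBbd, hball] with s hs12 hs2
      obtain ⟨-, hBs⟩ := hs12
      exact (ae_restrict_mem measurableSet_Ioi).mono fun r hr ↦ hdom s hs2 (fun r hr ↦ (hBs r hr).1) r hr
    · refine (ae_restrict_mem measurableSet_Ioi).mono fun r hr ↦ ?_
      have hrp : rPlus M a < r := hrmp.trans hr
      have hDc : ContinuousAt (fun s ↦ DQ M a m c s r) 0 :=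
        ContinuousAt.comp (f := fun s : ℝ ↦ ((s, r) : ℝ × ℝ))
          ((continuousOn_DQ (m := m) c h S.hc).continuousAt ((isOpen_univ.prod isOpen_Ioi).mem_nhds ⟨trivial, hrp⟩))
          (continuous_id.prodMk continuous_const).continuousAt
      exact (hDc.mul continuousAt_const).mul (hBcont0 r)
  -- (4c) the value at `0`
  have h4c : ∫ r in Ioi rm, DQ M a m c 0 r * cA h m c 0 r * cB m h J c 0 r = Cm * ∫ r in Ioi rm, DQ M a m c 0 r * cA h m c 0 r * cA h m c 0 r := by
    rw [← integral_const_mul]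
    refine setIntegral_congr_fun measurableSet_Ioi fun r hr ↦ ?_
    rw [hB0 (hrmR.trans hr)]; ring
  have h4 : Tendsto (fun s ↦ wronskian (cA h m c 0) (cA' h m c 0) (cB m h J c s) (cB' m h J c s) rm / s) (𝓝[≠] 0) (𝓝 (-(Cm * ∫ r in Ioi rm, DQ M a m c 0 r * cA h m c 0 r * cA h m c 0 r))) := by
    have hlim := (h4b.tendsto.mono_left (nhdsWithin_le_nhds (s := {(0 : ℝ)}ᶜ))).neg
    rw [h4c] at hlim
    exact hlim.congr' (h4a.mono fun s hs ↦ hs.symm)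
  ------------------------------------------------------------------
  -- Step 5: the cross term
  ------------------------------------------------------------------
  have h5 : Tendsto (fun s ↦ wronskian (cA h m c s - cA h m c 0) (cA' h m c s - cA' h m c 0) (cB m h J c s - cB m h J c 0) (cB' m h J c s - cB' m h J c 0) rm / s) (𝓝[≠] 0) (𝓝 0) := by
    obtain ⟨d1, d2⟩ := S.contDiffAt_cA hrmp
    obtain ⟨d3, d4⟩ := S.contDiffAt_cB rm
    have t1 := hasDerivAt_iff_tendsto_slope.1 (d1.differentiableAt one_ne_zero).hasDerivAt
    have t2 := hasDerivAt_iff_tendsto_slope.1 (d2.differentiableAt one_ne_zero).hasDerivAt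
    have t3 := hasDerivAt_iff_tendsto_slope.1 (d3.differentiableAt one_ne_zero).hasDerivAt
    have t4 := hasDerivAt_iff_tendsto_slope.1 (d4.differentiableAt one_ne_zero).hasDerivAt
    have ts : Tendsto (fun s : ℝ ↦ (s : ℂ)) (𝓝[≠] 0) (𝓝 0) := by
      have := Complex.continuous_ofReal.tendsto (0 : ℝ)
      rw [Complex.ofReal_zero] at this
      exact this.mono_left nhdsWithin_le_nhds
    have hprod := ts.mul ((t1.mul t4).sub (t2.mul t3))
    rw [zero_mul] at hprod
    refine hprod.congr' ?_
    filter_upwards [self_mem_nhdsWithin] with s hs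
    have hs' : (s : ℂ) ≠ 0 := by exact_mod_cast hs
    have e : (s : ℂ) * (s : ℂ)⁻¹ = 1 := mul_inv_cancel₀ hs'
    simp only [slope_def_module, sub_zero, wronskian, Pi.sub_apply, Complex.real_smul]
    push_cast
    rw [div_eq_mul_inv]
    linear_combination ((s : ℂ)⁻¹ * ((cA h m c s rm - cA h m c 0 rm) * (cB' m h J c s rm - cB' m h J c 0 rm) -
      (cA' h m c s rm - cA' h m c 0 rm) * (cB m h J c s rm - cB m h J c 0 rm))) * e
  ------------------------------------------------------------------
  -- Step 6: assemble
  ------------------------------------------------------------------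
  have hsum := ((h3.const_mul Cm).add h4).add h5
  rw [hasDerivAt_iff_tendsto_slope]
  have hlim : Tendsto (slope (matchW m h J c) 0) (𝓝[≠] 0)
      (𝓝 (Cm * (betaW h m c rh - ∫ r in rh..rm, DQ M a m c 0 r * cA h m c 0 r * cA h m c 0 r) + -(Cm * ∫ r in Ioi rm, DQ M a m c 0 r * cA h m c 0 r * cA h m c 0 r) + 0)) := by
    refine hsum.congr' ?_
    filter_upwards [self_mem_nhdsWithin] with s hs
    have hs' : (s : ℂ) ≠ 0 := by exact_mod_cast hs
    rw [slope_def_module, S.matchW_zero, sub_zero, hdecomp s]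
    simp only [Complex.real_smul, sub_zero]
    push_cast
    ring
  convert hlim using 2
  ring

end Deriv

end Literature.Barriers.FinalStateConjecture

end


/-!
# The horizon limit of the boundary term of the matching-function derivative

Topic `Literature/Barriers/FinalStateConjecture` (namespace `Literature.Barriers.FinalStateConjecture`),
continuing `KleinGordonMatchingSlope.lean` (`MSetup.hasDerivAt_matchW`: for every `r_h ∈ (r₊, r_m)`,
`𝒲'(0) = C_m(β(r_h) − ∫_{r_h}^{r_m} q̇y₀²) − C_m∫_{(r_m,∞)} q̇y₀²`). Here the boundary term
`β(r_h)` is computed on the horizon disc from the explicit local solution `y_s = √Δ P_s ρ_s`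
(`KleinGordonHorizonModes.lean`): **`β = P₀²(Δ(ρ̇ρ₀' − ρ̇'ρ₀) + i K̇ ρ₀²)`** — the variations of the
phase cancel (`betaW_eq_betaH`) — and its limit at the horizon is `i K̇(r₊) P(r₊)²`, `K̇ = ∂ₛK`,
`K = ω(r² + a²) − am` (`tendsto_betaH`; `ρ̇, ρ̇'` are continuous up to `r₊` because the Heun series is
jointly `C¹` in its variable and parameters). Since the derivative does not depend on `r_h`, letting
`r_h → r₊` gives the **horizon form of the derivative**
`𝒲'(0) = C_m( i K̇(r₊) P(r₊)² − ∫_{(r₊,∞)} q̇ y₀² )` (`MSetup.hasDerivAt_matchW_horizon`; the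
integrand is integrable at `r₊` because `q̇`'s numerator vanishes there, `am = 2Mr₊ω₀`). This is the
mechanism behind Shlapentokh-Rothman's computation `∂_ω Q_T(r₊) = −2Mr₊` (CMP 329 (2014), §4.3–4.4).
Everything is proved.

## References

* Y. Shlapentokh-Rothman, Comm. Math. Phys. 329 (2014) 859–891, §4.3 (Lemma 4.5), §4.4.
  Key `ShlapentokhRothman2014KleinGordon`.
-/

noncomputable section

open Set Filter Topology Complex MeasureTheory
open scoped ContDiff

namespace Literature.Barriers.FinalStateConjecture

open Literature.Geometry.Lorentzian Literature.Geometry.Lorentzian.Kerr Literature.Analysis.ODE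

variable {M a : ℝ} {m : ℤ}

/-! ### The local factors along a curve and their `s`-derivatives -/

/-- `P_s(r) = hzPhase (ω(s)) r`. [folklore] -/
def cP (M a : ℝ) (m : ℤ) (c : ℝ → HPar) (s r : ℝ) : ℂ := hzPhase M a m (c s).1 r
/-- `ρ_s(r)`. [folklore] -/
def cRho (M a : ℝ) (m : ℤ) (c : ℝ → HPar) (s r : ℝ) : ℂ := hzRhoC M a m (c s).1 (c s).2.1 (c s).2.2 (r : ℂ)
/-- `ρ_s'(r)`. [folklore] -/
def cRho' (M a : ℝ) (m : ℤ) (c : ℝ → HPar) (s r : ℝ) : ℂ := hzRhoC' M a m (c s).1 (c s).2.1 (c s).2.2 (r : ℂ)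
/-- `K_s(r) = ω(s)(r² + a²) − am`. [folklore] -/
def cK (a : ℝ) (m : ℤ) (c : ℝ → HPar) (s r : ℝ) : ℂ := hzK a m (c s).1 r

/-- `ρ̇(r) = ∂ₛρ_s(r)|₀`. [folklore] -/
def dRho (M a : ℝ) (m : ℤ) (c : ℝ → HPar) (r : ℝ) : ℂ := deriv (fun s ↦ cRho M a m c s r) 0
/-- `ρ̇'(r) = ∂ₛρ_s'(r)|₀`. [folklore] -/
def dRho' (M a : ℝ) (m : ℤ) (c : ℝ → HPar) (r : ℝ) : ℂ := deriv (fun s ↦ cRho' M a m c s r) 0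
/-- `K̇(r) = ∂ₛK_s(r)|₀`. [folklore] -/
def dK (a : ℝ) (m : ℤ) (c : ℝ → HPar) (r : ℝ) : ℂ := deriv (fun s ↦ cK a m c s r) 0
/-- `Ṗ(r) = ∂ₛP_s(r)|₀`. [folklore] -/
def dP (M a : ℝ) (m : ℤ) (c : ℝ → HPar) (r : ℝ) : ℂ := deriv (fun s ↦ cP M a m c s r) 0

/-- **The horizon form of the boundary term**: `β_H(r) = P₀²(Δ(ρ̇ρ₀' − ρ̇'ρ₀) + i K̇ ρ₀²)`. [folklore] -/
def betaH (M a : ℝ) (m : ℤ) (c : ℝ → HPar) (r : ℝ) : ℂ :=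
  cP M a m c 0 r ^ 2 * ((delta M a r : ℂ) * (dRho M a m c r * cRho' M a m c 0 r - dRho' M a m c r * cRho M a m c 0 r) +
    I * dK a m c r * cRho M a m c 0 r ^ 2)

section Horizon

variable {h : IsSubextremal M a} {J : JD M a} {c : ℝ → HPar} {lam μ : ℝ} {Cm : ℂ} {C k S₁ : ℝ}

/-- Differentiability in `s` of the local factors at `s = 0` (`|r − r₊| < 2c/5` for `ρ`, `ρ'`). [folklore] -/
theorem MSetup.hasDerivAt_factors (S : MSetup h m J c lam μ Cm C k S₁) {r : ℝ} (hr : |r - rPlus M a| < 2 * hzC M a / 5) :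
    HasDerivAt (fun s ↦ cP M a m c s r) (dP M a m c r) 0 ∧ HasDerivAt (fun s ↦ cRho M a m c s r) (dRho M a m c r) 0 ∧
      HasDerivAt (fun s ↦ cRho' M a m c s r) (dRho' M a m c r) 0 ∧ HasDerivAt (fun s ↦ cK a m c s r) (dK a m c r) 0 := by
  have h0 : c 0 ∈ hzU M a m := by rw [S.hc0]; exact mem_hzU_omega0 h lam μ
  have hc1 : ContDiffAt ℝ 1 c 0 := S.hc.contDiffAt
  have dPd : DifferentiableAt ℝ (fun s ↦ cP M a m c s r) 0 :=
    (((contDiff_hzPhase_par (M := M) (a := a) (m := m) r (n := 1)).contDiffAt).comp 0 hc1).differentiableAt one_ne_zero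
  have dρd : DifferentiableAt ℝ (fun s ↦ cRho M a m c s r) 0 :=
    ((contDiffAt_hzRhoC_par (m := m) h h0 hr (n := 1)).comp 0 hc1).differentiableAt one_ne_zero
  have dρ'd : DifferentiableAt ℝ (fun s ↦ cRho' M a m c s r) 0 :=
    ((contDiffAt_hzRhoC'_par (m := m) h h0 hr (n := 1)).comp 0 hc1).differentiableAt one_ne_zero
  have dKd : DifferentiableAt ℝ (fun s ↦ cK a m c s r) 0 :=
    (((contDiff_hzK_par (a := a) (m := m) r (n := 1)).contDiffAt).comp 0 hc1).differentiableAt one_ne_zero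
  exact ⟨dPd.hasDerivAt, dρd.hasDerivAt, dρ'd.hasDerivAt, dKd.hasDerivAt⟩

/-- **The boundary term on the horizon disc**: `β(r_h) = β_H(r_h)` for `r_h ∈ (r₊, r₊ + 2c/5)`
(the variation of the phase and the `K₀ρ̇` terms cancel). [folklore] -/
theorem MSetup.betaW_eq_betaH (S : MSetup h m J c lam μ Cm C k S₁) {rh : ℝ} (hrh : rh ∈ Ioo (rPlus M a) (rPlus M a + 2 * hzC M a / 5)) :
    betaW h m c rh = betaH M a m c rh := by
  have hcpos := hzC_pos h
  have habs : |rh - rPlus M a| < 2 * hzC M a / 5 := by rw [abs_lt]; constructor <;> linarith [hrh.1, hrh.2]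
  obtain ⟨hP, hρ, hρ', hK⟩ := S.hasDerivAt_factors habs
  have hΔ : 0 < delta M a rh := delta_pos_of_gt h hrh.1
  have hΔc : (delta M a rh : ℂ) ≠ 0 := by exact_mod_cast hΔ.ne'
  set Sq : ℝ := Real.sqrt (delta M a rh) with hSq
  have hSq0 : Sq ≠ 0 := (Real.sqrt_pos.2 hΔ).ne'
  have hSqc : (Sq : ℂ) ≠ 0 := by exact_mod_cast hSq0
  have hsq : (Sq : ℂ) ^ 2 = (delta M a rh : ℂ) := by rw [hSq]; exact_mod_cast Real.sq_sqrt hΔ.le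
  -- the values agree with the explicit local solution for `s` near `0`
  have hU := S.eventually_mem_hzU
  have hA : (fun s ↦ cA h m c s rh) =ᶠ[𝓝 0] fun s ↦ (Sq : ℂ) * (cP M a m c s rh * cRho M a m c s rh) := by
    filter_upwards [hU] with s hs
    simp only [cA, yh, (hPair_eqOn (m := m) h hs).1 hrh, hzRloc, cP, cRho, hSq]
  have hA' : (fun s ↦ cA' h m c s rh) =ᶠ[𝓝 0] fun s ↦ (((2 * rh - 2 * M) / (2 * Sq) : ℝ) : ℂ) * (cP M a m c s rh * cRho M a m c s rh) +
      (Sq : ℂ) * (cP M a m c s rh * (cRho' M a m c s rh - I * (cK a m c s rh / (delta M a rh : ℂ)) * cRho M a m c s rh)) := by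
    filter_upwards [hU] with s hs
    simp only [cA', yh', (hPair_eqOn (m := m) h hs).1 hrh, (hPair_eqOn (m := m) h hs).2 hrh, hzRloc, hzRloc', cP, cRho, cRho', cK, hSq]
  -- the `s`-derivatives of these formulas
  have e1 : HasDerivAt (fun s ↦ (Sq : ℂ) * (cP M a m c s rh * cRho M a m c s rh))
      ((Sq : ℂ) * (dP M a m c rh * cRho M a m c 0 rh + cP M a m c 0 rh * dRho M a m c rh)) 0 := (hP.mul hρ).const_mul _
  have e2 : HasDerivAt (fun s ↦ (((2 * rh - 2 * M) / (2 * Sq) : ℝ) : ℂ) * (cP M a m c s rh * cRho M a m c s rh) +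
      (Sq : ℂ) * (cP M a m c s rh * (cRho' M a m c s rh - I * (cK a m c s rh / (delta M a rh : ℂ)) * cRho M a m c s rh)))
      ((((2 * rh - 2 * M) / (2 * Sq) : ℝ) : ℂ) * (dP M a m c rh * cRho M a m c 0 rh + cP M a m c 0 rh * dRho M a m c rh) +
        (Sq : ℂ) * (dP M a m c rh * (cRho' M a m c 0 rh - I * (cK a m c 0 rh / (delta M a rh : ℂ)) * cRho M a m c 0 rh) +
          cP M a m c 0 rh * (dRho' M a m c rh - (I * (dK a m c rh / (delta M a rh : ℂ)) * cRho M a m c 0 rh +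
            I * (cK a m c 0 rh / (delta M a rh : ℂ)) * dRho M a m c rh)))) 0 := by
    have hin : HasDerivAt (fun s ↦ cRho' M a m c s rh - I * (cK a m c s rh / (delta M a rh : ℂ)) * cRho M a m c s rh)
        (dRho' M a m c rh - (I * (dK a m c rh / (delta M a rh : ℂ)) * cRho M a m c 0 rh + I * (cK a m c 0 rh / (delta M a rh : ℂ)) * dRho M a m c rh)) 0 := by
      have h1 := ((hK.div_const (delta M a rh : ℂ)).const_mul I).mul hρ
      exact hρ'.sub h1
    exact ((hP.mul hρ).const_mul _).add ((hP.mul hin).const_mul _)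
  have d1 : dA h m c rh = (Sq : ℂ) * (dP M a m c rh * cRho M a m c 0 rh + cP M a m c 0 rh * dRho M a m c rh) := by
    rw [dA, hA.deriv_eq]; exact e1.deriv
  have d2 : dA' h m c rh =
      (((2 * rh - 2 * M) / (2 * Sq) : ℝ) : ℂ) * (dP M a m c rh * cRho M a m c 0 rh + cP M a m c 0 rh * dRho M a m c rh) +
        (Sq : ℂ) * (dP M a m c rh * (cRho' M a m c 0 rh - I * (cK a m c 0 rh / (delta M a rh : ℂ)) * cRho M a m c 0 rh) +
          cP M a m c 0 rh * (dRho' M a m c rh - (I * (dK a m c rh / (delta M a rh : ℂ)) * cRho M a m c 0 rh +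
            I * (cK a m c 0 rh / (delta M a rh : ℂ)) * dRho M a m c rh))) := by
    rw [dA', hA'.deriv_eq]; exact e2.deriv
  have v1 : cA h m c 0 rh = (Sq : ℂ) * (cP M a m c 0 rh * cRho M a m c 0 rh) := hA.eq_of_nhds
  have v2 : cA' h m c 0 rh = (((2 * rh - 2 * M) / (2 * Sq) : ℝ) : ℂ) * (cP M a m c 0 rh * cRho M a m c 0 rh) +
      (Sq : ℂ) * (cP M a m c 0 rh * (cRho' M a m c 0 rh - I * (cK a m c 0 rh / (delta M a rh : ℂ)) * cRho M a m c 0 rh)) := hA'.eq_of_nhds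
  rw [betaW, d1, d2, v1, v2, betaH]
  push_cast
  field_simp
  linear_combination ((cP M a m c 0 rh) ^ 2 * (dRho M a m c rh * cRho' M a m c 0 rh - dRho' M a m c rh * cRho M a m c 0 rh) *
    (delta M a rh : ℂ) + (cP M a m c 0 rh) ^ 2 * (cRho M a m c 0 rh) ^ 2 * I * dK a m c rh) * hsq

/-! ### The horizon limit of `β_H` -/

/-- The joint local map `Φ(s, r) = ρ_{c s}(r)` and `Φ'(s, r) = ρ'_{c s}(r)` are `C¹` on the open
set `{c s ∈ hzU, |r − r₊| < 2c/5}`. [folklore] -/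
theorem MSetup.contDiffOn_rho_joint (S : MSetup h m J c lam μ Cm C k S₁) :
    ContDiffOn ℝ 1 (fun x : ℝ × ℝ ↦ cRho M a m c x.1 x.2) {x : ℝ × ℝ | c x.1 ∈ hzU M a m ∧ |x.2 - rPlus M a| < 2 * hzC M a / 5} ∧
      ContDiffOn ℝ 1 (fun x : ℝ × ℝ ↦ cRho' M a m c x.1 x.2) {x : ℝ × ℝ | c x.1 ∈ hzU M a m ∧ |x.2 - rPlus M a| < 2 * hzC M a / 5} := by
  have hin : ContDiff ℝ 1 fun x : ℝ × ℝ ↦ ((c x.1, x.2) : HPar × ℝ) := (S.hc.comp contDiff_fst).prodMk contDiff_snd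
  constructor
  · intro x hx
    have hj := contDiffAt_hzRhoC_joint2 (m := m) h (x := (c x.1, x.2)) hx.1 hx.2 (n := 1)
    exact (hj.comp x hin.contDiffAt).contDiffWithinAt
  · intro x hx
    have hj := contDiffAt_hzRhoC'_joint2 (m := m) h (x := (c x.1, x.2)) hx.1 hx.2 (n := 1)
    exact (hj.comp x hin.contDiffAt).contDiffWithinAt

/-- The set `{c s ∈ hzU, |r − r₊| < 2c/5}` is open and contains `(0, r₊)`. [folklore] -/
theorem MSetup.isOpen_rhoDom (S : MSetup h m J c lam μ Cm C k S₁) :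
    IsOpen {x : ℝ × ℝ | c x.1 ∈ hzU M a m ∧ |x.2 - rPlus M a| < 2 * hzC M a / 5} ∧
      ((0 : ℝ), rPlus M a) ∈ {x : ℝ × ℝ | c x.1 ∈ hzU M a m ∧ |x.2 - rPlus M a| < 2 * hzC M a / 5} := by
  constructor
  · refine IsOpen.inter ?_ ?_
    · exact (isOpen_hzU.preimage S.hc.continuous).preimage continuous_fst
    · have hc : Continuous fun x : ℝ × ℝ ↦ |x.2 - rPlus M a| := by fun_prop
      exact isOpen_lt hc continuous_const
  · refine ⟨?_, ?_⟩
    · show c 0 ∈ hzU M a m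
      rw [S.hc0]; exact mem_hzU_omega0 h lam μ
    · show |rPlus M a - rPlus M a| < 2 * hzC M a / 5
      rw [sub_self, abs_zero]; exact by have := hzC_pos h; positivity

/-- **`ρ̇` and `ρ̇'` are continuous at `r₊`** (partial derivatives of a jointly `C¹` map). [folklore] -/
theorem MSetup.continuousAt_dRho (S : MSetup h m J c lam μ Cm C k S₁) :
    ContinuousAt (dRho M a m c) (rPlus M a) ∧ ContinuousAt (dRho' M a m c) (rPlus M a) := by
  obtain ⟨hO, h0⟩ := S.isOpen_rhoDom
  obtain ⟨hΦ, hΦ'⟩ := S.contDiffOn_rho_joint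
  set U := {x : ℝ × ℝ | c x.1 ∈ hzU M a m ∧ |x.2 - rPlus M a| < 2 * hzC M a / 5} with hU
  -- a general principle: for `Φ` of class `C¹` on the open `U ∋ (0, r)`, `deriv (Φ(·, r)) 0 = fderiv Φ (0, r) (1, 0)`
  have key : ∀ (Φ : ℝ × ℝ → ℂ), ContDiffOn ℝ 1 Φ U → ∀ r, ((0 : ℝ), r) ∈ U →
      deriv (fun s ↦ Φ (s, r)) 0 = fderiv ℝ Φ ((0 : ℝ), r) ((1 : ℝ), (0 : ℝ)) := by
    intro Φ hΦ r hr
    have hd : HasFDerivAt Φ (fderiv ℝ Φ ((0 : ℝ), r)) ((0 : ℝ), r) :=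
      ((hΦ.contDiffAt (hO.mem_nhds hr)).differentiableAt one_ne_zero).hasFDerivAt
    have hl : HasDerivAt (fun s : ℝ ↦ ((s, r) : ℝ × ℝ)) ((1 : ℝ), (0 : ℝ)) 0 :=
      (hasDerivAt_id (0 : ℝ)).prodMk (hasDerivAt_const (0 : ℝ) r)
    exact (hd.comp_hasDerivAt (0 : ℝ) hl).deriv
  -- continuity of `r ↦ fderiv Φ (0, r) (1, 0)` at `r₊`
  have cont : ∀ (Φ : ℝ × ℝ → ℂ), ContDiffOn ℝ 1 Φ U →
      ContinuousAt (fun r ↦ fderiv ℝ Φ ((0 : ℝ), r) ((1 : ℝ), (0 : ℝ))) (rPlus M a) := by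
    intro Φ hΦ
    have hcf : ContinuousOn (fderiv ℝ Φ) U := hΦ.continuousOn_fderiv_of_isOpen hO le_rfl
    have hca : ContinuousAt (fderiv ℝ Φ) ((0 : ℝ), rPlus M a) := hcf.continuousAt (hO.mem_nhds h0)
    have hin : ContinuousAt (fun r : ℝ ↦ (((0 : ℝ), r) : ℝ × ℝ)) (rPlus M a) := (continuous_const.prodMk continuous_id).continuousAt
    have hcomp := ContinuousAt.comp (f := fun r : ℝ ↦ (((0 : ℝ), r) : ℝ × ℝ)) hca hin
    exact hcomp.clm_apply continuousAt_const
  -- both derivatives agree with the `fderiv` expressions near `r₊`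
  have hnear : ∀ᶠ r in 𝓝 (rPlus M a), ((0 : ℝ), r) ∈ U := by
    have hin : Continuous fun r : ℝ ↦ (((0 : ℝ), r) : ℝ × ℝ) := continuous_const.prodMk continuous_id
    exact hin.continuousAt.preimage_mem_nhds (hO.mem_nhds h0)
  constructor
  · have hev : dRho M a m c =ᶠ[𝓝 (rPlus M a)] fun r ↦ fderiv ℝ (fun x : ℝ × ℝ ↦ cRho M a m c x.1 x.2) ((0 : ℝ), r) ((1 : ℝ), (0 : ℝ)) := by
      filter_upwards [hnear] with r hr
      exact key _ hΦ r hr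
    exact (cont _ hΦ).congr_of_eventuallyEq hev
  · have hev : dRho' M a m c =ᶠ[𝓝 (rPlus M a)] fun r ↦ fderiv ℝ (fun x : ℝ × ℝ ↦ cRho' M a m c x.1 x.2) ((0 : ℝ), r) ((1 : ℝ), (0 : ℝ)) := by
      filter_upwards [hnear] with r hr
      exact key _ hΦ' r hr
    exact (cont _ hΦ').congr_of_eventuallyEq hev

/-- `K̇(r) = ω̇ (r² + a²)`, `ω̇ = ∂ₛ ω(s)|₀`. [folklore] -/
theorem MSetup.dK_eq (S : MSetup h m J c lam μ Cm C k S₁) (r : ℝ) :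
    dK a m c r = deriv (fun s ↦ (c s).1) 0 * ((r : ℂ) ^ 2 + a ^ 2) := by
  have hd : HasDerivAt (fun s ↦ (c s).1) (deriv (fun s ↦ (c s).1) 0) 0 := by
    have : DifferentiableAt ℝ (fun s ↦ (c s).1) 0 :=
      ((contDiff_fst (𝕜 := ℝ) (E := ℂ) (F := ℂ × ℝ)).contDiffAt.comp 0 S.hc.contDiffAt).differentiableAt one_ne_zero
    exact this.hasDerivAt
  have h1 : HasDerivAt (fun s ↦ cK a m c s r) (deriv (fun s ↦ (c s).1) 0 * ((r : ℂ) ^ 2 + a ^ 2)) 0 := by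
    unfold cK hzK
    exact (hd.mul_const ((r : ℂ) ^ 2 + a ^ 2)).sub_const ((a : ℂ) * (m : ℂ))
  exact h1.deriv

/-- **The horizon limit of the boundary term**: `β_H(r) → i K̇(r₊) P(r₊)²` as `r → r₊⁺`
(`Δ → 0`, `ρ₀ → 1`, `ρ̇, ρ̇', ρ₀'` bounded, `P₀ → P(r₊)`). [cite: ShlapentokhRothman2014KleinGordon, §4.4] -/
theorem MSetup.tendsto_betaH (S : MSetup h m J c lam μ Cm C k S₁) :
    Tendsto (betaH M a m c) (𝓝[>] rPlus M a) (𝓝 (I * dK a m c (rPlus M a) * radCst M a m ^ 2)) := by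
  have hcpos := hzC_pos h
  obtain ⟨hO, h0⟩ := S.isOpen_rhoDom
  obtain ⟨cdρ, cdρ'⟩ := S.continuousAt_dRho
  have hp0 : c 0 ∈ hzU M a m := by rw [S.hc0]; exact mem_hzU_omega0 h lam μ
  have habs : |rPlus M a - rPlus M a| < 2 * hzC M a / 5 := by rw [sub_self, abs_zero]; positivity
  -- continuity of the base factors at `r₊`
  have hin : ContinuousAt (fun r : ℝ ↦ ((c 0, r) : HPar × ℝ)) (rPlus M a) := (continuous_const.prodMk continuous_id).continuousAt
  have cρ : ContinuousAt (cRho M a m c 0) (rPlus M a) := by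
    have hj := (contDiffAt_hzRhoC_joint2 (m := m) h (x := (c 0, rPlus M a)) hp0 habs (n := 0)).continuousAt
    exact ContinuousAt.comp (f := fun r : ℝ ↦ ((c 0, r) : HPar × ℝ)) hj hin
  have cρ' : ContinuousAt (cRho' M a m c 0) (rPlus M a) := by
    have hj := (contDiffAt_hzRhoC'_joint2 (m := m) h (x := (c 0, rPlus M a)) hp0 habs (n := 0)).continuousAt
    exact ContinuousAt.comp (f := fun r : ℝ ↦ ((c 0, r) : HPar × ℝ)) hj hin
  have cPh : ContinuousAt (cP M a m c 0) (rPlus M a) := by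
    have : cP M a m c 0 = hzPhase M a m (kgOmega0 M a m) := by funext r; simp [cP, S.hc0]
    rw [this]
    exact continuousAt_hzPhase_omega0 (m := m) h h.rMinus_lt_rPlus
  have cKd : ContinuousAt (dK a m c) (rPlus M a) := by
    have : dK a m c = fun r : ℝ ↦ deriv (fun s ↦ (c s).1) 0 * ((r : ℂ) ^ 2 + a ^ 2) := funext (S.dK_eq)
    rw [this]
    exact (continuousAt_const.mul (by fun_prop : Continuous fun r : ℝ ↦ (r : ℂ) ^ 2 + a ^ 2).continuousAt)
  have cΔ : ContinuousAt (fun r ↦ (delta M a r : ℂ)) (rPlus M a) := by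
    have : Continuous fun r : ℝ ↦ (delta M a r : ℂ) := by unfold delta; fun_prop
    exact this.continuousAt
  -- the values at `r₊`
  have vρ : cRho M a m c 0 (rPlus M a) = 1 := by simp [cRho, hzRhoC, hzXi, heunFun_zero]
  have vP : cP M a m c 0 (rPlus M a) = radCst M a m := by simp [cP, S.hc0, radCst]
  have vΔ : (delta M a (rPlus M a) : ℂ) = 0 := by rw [delta_rPlus h.le]; simp
  have hF : ContinuousAt (betaH M a m c) (rPlus M a) := by
    unfold betaH
    exact (cPh.pow 2).mul ((cΔ.mul ((cdρ.mul cρ').sub (cdρ'.mul cρ))).add ((continuousAt_const.mul cKd).mul (cρ.pow 2)))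
  have hval : betaH M a m c (rPlus M a) = I * dK a m c (rPlus M a) * radCst M a m ^ 2 := by
    simp only [betaH, vρ, vP, vΔ, zero_mul, zero_add, one_pow, mul_one]
    ring
  have := hF.tendsto
  rw [hval] at this
  exact this.mono_left nhdsWithin_le_nhds

/-! ### The horizon form of the derivative -/

/-- `ω̇`, the `s`-derivative of the frequency along the curve. [folklore] -/
def dOmega (c : ℝ → HPar) : ℂ := deriv (fun s ↦ (c s).1) 0

/-- **The reduced numerator of `q̇`**:
`Q_n(r) = −2ω₀ω̇ r(r² + r₊r + r₊² + a²) + (r − r₋)(Λ̇ + r²η̇)`. [folklore] -/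
def dQnum (M a : ℝ) (m : ℤ) (c : ℝ → HPar) (r : ℝ) : ℂ :=
  -2 * (kgOmega0 M a m : ℂ) * dOmega c * r * (((r ^ 2 + rPlus M a * r + rPlus M a ^ 2 + a ^ 2 : ℝ)) : ℂ) +
    (((r - rMinus M a : ℝ)) : ℂ) * (deriv (cg3 c) 0 + (((r ^ 2 : ℝ)) : ℂ) * deriv (cg4 c) 0)

/-- `∂ₛ ω² |₀ = 2ω₀ ω̇`. [folklore] -/
theorem MSetup.deriv_cg1 (S : MSetup h m J c lam μ Cm C k S₁) : deriv (cg1 c) 0 = 2 * (kgOmega0 M a m : ℂ) * dOmega c := by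
  have hd : HasDerivAt (fun s ↦ (c s).1) (dOmega c) 0 := by
    have : DifferentiableAt ℝ (fun s ↦ (c s).1) 0 :=
      ((contDiff_fst (𝕜 := ℝ) (E := ℂ) (F := ℂ × ℝ)).contDiffAt.comp 0 S.hc.contDiffAt).differentiableAt one_ne_zero
    exact this.hasDerivAt
  have h2 : HasDerivAt (cg1 c) (2 * (c 0).1 * dOmega c) 0 := by
    have := hd.mul hd
    refine (this.congr_of_eventuallyEq (Eventually.of_forall fun s ↦ by simp [cg1, sq])).congr_deriv (by ring)
  rw [h2.deriv, S.hc0]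

/-- **`q̇ = Q_n/((r − r₋)Δ)` on `(r₊, ∞)`**: the numerator of `q̇` vanishes at `r₊`
(`am = 2Mr₊ω₀`, `r₊² + a² = 2Mr₊`) and factors through `r − r₊`. [folklore] -/
theorem MSetup.DQ_zero_eq (S : MSetup h m J c lam μ Cm C k S₁) {r : ℝ} (hr : rPlus M a < r) :
    DQ M a m c 0 r = dQnum M a m c r / ((((r - rMinus M a : ℝ)) : ℂ) * (delta M a r : ℂ)) := by
  have hM : M ≠ 0 := h.pos.ne'
  have hrp : rPlus M a ≠ 0 := (lt_of_le_of_lt h.rMinus_nonneg h.rMinus_lt_rPlus).ne'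
  have ham := a_mul_m_eq (m := m) hM hrp
  have hsq : rPlus M a ^ 2 + a ^ 2 = 2 * M * rPlus M a := by
    have h0 := delta_rPlus h.le
    unfold delta at h0
    linarith
  have hΔm : delta M a r = (r - rPlus M a) * (r - rMinus M a) := delta_eq_mul h.le r
  have hΔ0 : (delta M a r : ℂ) ≠ 0 := by exact_mod_cast (delta_pos_of_gt h hr).ne'
  have hrm : (((r - rMinus M a : ℝ)) : ℂ) ≠ 0 := by
    have : 0 < r - rMinus M a := by linarith [h.rMinus_lt_rPlus]
    exact_mod_cast this.ne'
  have hd2 : deriv (cg2 c) 0 = dOmega c := rfl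
  simp only [DQ, dd_zero, S.deriv_cg1, hd2, dQnum]
  rw [div_eq_div_iff (pow_ne_zero 2 hΔ0) (mul_ne_zero hrm hΔ0)]
  have hΔc : (delta M a r : ℂ) = ((r : ℂ) - rPlus M a) * ((r : ℂ) - rMinus M a) := by rw [hΔm]; push_cast; ring
  have hΔe : ((r : ℂ) - rPlus M a) * ((r : ℂ) - rMinus M a) = (r : ℂ) ^ 2 - 2 * M * r + a ^ 2 := by
    have h1 : (r - rPlus M a) * (r - rMinus M a) = r ^ 2 - 2 * M * r + a ^ 2 := by rw [← hΔm]; rfl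
    exact_mod_cast h1
  have hamc : ((a : ℂ) * (m : ℂ)) = 2 * M * rPlus M a * (kgOmega0 M a m : ℂ) := by exact_mod_cast ham
  have hsqc : (rPlus M a : ℂ) ^ 2 + (a : ℂ) ^ 2 = 2 * M * rPlus M a := by exact_mod_cast hsq
  push_cast
  rw [hΔc]
  linear_combination (((r : ℂ) - rMinus M a) * (((r : ℂ) - rPlus M a) * ((r : ℂ) - rMinus M a))) *
      ((4 * M * (r : ℂ) * dOmega c) * hamc + (-(2 * (kgOmega0 M a m : ℂ) * dOmega c * r * (2 * M + rPlus M a))) * hsqc +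
        (2 * (kgOmega0 M a m : ℂ) * dOmega c * a ^ 2) * hΔe)

/-! ### Integrability of `q̇ y₀²` and the horizon form of the derivative -/

/-- **The derivative integrand** `g = q̇ y₀ y₀` (`y₀ = y_{c 0}`). [folklore] -/
def dInt (h : IsSubextremal M a) (m : ℤ) (c : ℝ → HPar) (r : ℝ) : ℂ := DQ M a m c 0 r * cA h m c 0 r * cA h m c 0 r

/-- **`g` is integrable on `(r₊, ∞)`**: near `r₊` it is `(Q_n/(r − r₋))·(P₀ρ₀)²` (continuous up to
`r₊`), in the middle it is continuous, and beyond `r_m` it is bounded by a decaying exponential. [folklore] -/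
theorem MSetup.integrableOn_dInt (S : MSetup h m J c lam μ Cm C k S₁) : IntegrableOn (dInt h m c) (Ioi (rPlus M a)) := by
  have hcpos := hzC_pos h
  set rm := J.R₁ + 1 with hrm
  have hRr : rPlus M a < J.R₁ := (delta_ge_of_far h J.hR).2.2.1
  have hrmp : rPlus M a < rm := by rw [hrm]; linarith
  have hp0 : c 0 ∈ hzU M a m := by rw [S.hc0]; exact mem_hzU_omega0 h lam μ
  -- continuity of `g` on `(r₊, ∞)`
  have hA0c : ContinuousOn (cA h m c 0) (Ioi (rPlus M a)) := (isSol2_cA (h := h) (m := m) (c := c) 0).continuousOn.1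
  have hD0c : ContinuousOn (DQ M a m c 0) (Ioi (rPlus M a)) :=
    (continuousOn_DQ (m := m) c h S.hc).comp (f := fun r : ℝ ↦ (((0 : ℝ), r) : ℝ × ℝ)) (Continuous.continuousOn (by fun_prop))
      fun r hr ↦ ⟨trivial, hr⟩
  have hgc : ContinuousOn (dInt h m c) (Ioi (rPlus M a)) := (hD0c.mul hA0c).mul hA0c
  -- (a) near the horizon
  set r₁ := rPlus M a + hzC M a / 5 with hr₁
  have hr₁p : rPlus M a < r₁ := by rw [hr₁]; linarith
  have hnear : IntegrableOn (dInt h m c) (Ioc (rPlus M a) r₁) := by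
    set G : ℝ → ℂ := fun r ↦ dQnum M a m c r / (((r - rMinus M a : ℝ)) : ℂ) * (cP M a m c 0 r * cRho M a m c 0 r) ^ 2 with hG
    have hGc : ContinuousOn G (Icc (rPlus M a) r₁) := by
      intro r hr
      have hrm : rMinus M a < r := lt_of_lt_of_le h.rMinus_lt_rPlus hr.1
      have habs : |r - rPlus M a| < 2 * hzC M a / 5 := by rw [abs_lt]; constructor <;> linarith [hr.1, hr.2]
      have hin : ContinuousAt (fun r : ℝ ↦ ((c 0, r) : HPar × ℝ)) r := (continuous_const.prodMk continuous_id).continuousAt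
      have cρ : ContinuousAt (cRho M a m c 0) r := by
        have hj := (contDiffAt_hzRhoC_joint2 (m := m) h (x := (c 0, r)) hp0 habs (n := 0)).continuousAt
        exact ContinuousAt.comp (f := fun r : ℝ ↦ ((c 0, r) : HPar × ℝ)) hj hin
      have cPh : ContinuousAt (cP M a m c 0) r := by
        have : cP M a m c 0 = hzPhase M a m (kgOmega0 M a m) := by funext r; simp [cP, S.hc0]
        rw [this]; exact continuousAt_hzPhase_omega0 (m := m) h hrm
      have cQ : ContinuousAt (fun r ↦ dQnum M a m c r / (((r - rMinus M a : ℝ)) : ℂ)) r := by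
        have hnum : Continuous fun r : ℝ ↦ dQnum M a m c r := by unfold dQnum; fun_prop
        have hden : Continuous fun r : ℝ ↦ (((r - rMinus M a : ℝ)) : ℂ) := by fun_prop
        refine hnum.continuousAt.div hden.continuousAt ?_
        have : 0 < r - rMinus M a := by linarith
        exact_mod_cast this.ne'
      exact (cQ.mul ((cPh.mul cρ).pow 2)).continuousWithinAt
    have hGi : IntegrableOn G (Icc (rPlus M a) r₁) := hGc.integrableOn_compact isCompact_Icc
    refine (hGi.mono_set Ioc_subset_Icc_self).congr_fun (fun r hr ↦ ?_) measurableSet_Ioc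
    -- `G = g` on `(r₊, r₁]`
    have hrI : r ∈ Ioo (rPlus M a) (rPlus M a + 2 * hzC M a / 5) := ⟨hr.1, by linarith [hr.2]⟩
    have hΔ : 0 < delta M a r := delta_pos_of_gt h hr.1
    have hΔc : (delta M a r : ℂ) ≠ 0 := by exact_mod_cast hΔ.ne'
    have hrmc : (((r - rMinus M a : ℝ)) : ℂ) ≠ 0 := by
      have : 0 < r - rMinus M a := by linarith [h.rMinus_lt_rPlus, hr.1]
      exact_mod_cast this.ne'
    have hsq : ((Real.sqrt (delta M a r) : ℝ) : ℂ) ^ 2 = (delta M a r : ℂ) := by exact_mod_cast Real.sq_sqrt hΔ.le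
    have hA : cA h m c 0 r = ((Real.sqrt (delta M a r) : ℝ) : ℂ) * (cP M a m c 0 r * cRho M a m c 0 r) := by
      simp only [cA, yh, (hPair_eqOn (m := m) h hp0).1 hrI, hzRloc, cP, cRho]
    simp only [hG, dInt, hA, S.DQ_zero_eq hr.1]
    field_simp
    linear_combination (-(dQnum M a m c r * (cP M a m c 0 r * cRho M a m c 0 r) ^ 2)) * hsq
  -- (b) the middle piece
  have hmid : IntegrableOn (dInt h m c) (Icc r₁ rm) :=
    (hgc.mono fun r hr ↦ lt_of_lt_of_le hr₁p hr.1).integrableOn_compact isCompact_Icc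
  -- (c) the tail
  obtain ⟨L, hL⟩ := exists_bound_DQ (m := m) c h S.hc J.hR J.hR1
  have hdec1 := yh_base_decay (m := m) h lam μ S.hpos S.hS₁ S.hdec
  have htail : IntegrableOn (dInt h m c) (Ioi rm) := by
    have hk2 : 0 < 2 * k := by linarith [S.hk]
    have hI : IntegrableOn (fun x ↦ L * (‖radCst M a m‖ * C) ^ 2 * Real.exp (-(2 * k) * x)) (Ioi rm) :=
      (exp_neg_integrableOn_Ioi rm hk2).const_mul _
    refine Integrable.mono' hI ((hgc.mono (Ioi_subset_Ioi hrmp.le)).aestronglyMeasurable measurableSet_Ioi) ?_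
    refine (ae_restrict_mem measurableSet_Ioi).mono fun r hr ↦ ?_
    have hrR : J.R₁ ≤ r := by simp only [mem_Ioi, hrm] at hr; linarith
    have hrS : S₁ ≤ r := by simp only [mem_Ioi, hrm] at hr; linarith [S.hS₁R]
    have h1 : ‖DQ M a m c 0 r‖ ≤ L := hL 0 (by norm_num) r hrR
    have h2 : ‖cA h m c 0 r‖ ≤ ‖radCst M a m‖ * C * Real.exp (-(k * r)) := by
      simp only [cA, S.hc0]; exact (hdec1 r hrS).1
    have hL0 : 0 ≤ L := le_trans (norm_nonneg _) h1
    have hA0 : 0 ≤ ‖radCst M a m‖ * C * Real.exp (-(k * r)) := le_trans (norm_nonneg _) h2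
    have e : Real.exp (-(2 * k) * r) = Real.exp (-(k * r)) * Real.exp (-(k * r)) := by rw [← Real.exp_add]; congr 1; ring
    rw [dInt, norm_mul, norm_mul, e]
    calc ‖DQ M a m c 0 r‖ * ‖cA h m c 0 r‖ * ‖cA h m c 0 r‖ ≤ L * (‖radCst M a m‖ * C * Real.exp (-(k * r))) * (‖radCst M a m‖ * C * Real.exp (-(k * r))) :=
          mul_le_mul (mul_le_mul h1 h2 (norm_nonneg _) hL0) h2 (norm_nonneg _) (mul_nonneg hL0 hA0)
      _ = L * (‖radCst M a m‖ * C) ^ 2 * (Real.exp (-(k * r)) * Real.exp (-(k * r))) := by ring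
  -- assemble
  have h1 : IntegrableOn (dInt h m c) (Ioc (rPlus M a) rm) :=
    (hnear.union hmid).mono_set fun r hr ↦ by
      rcases le_or_gt r r₁ with h' | h'
      · exact Or.inl ⟨hr.1, h'⟩
      · exact Or.inr ⟨h'.le, hr.2⟩
  have h2 := h1.union htail
  rwa [Ioc_union_Ioi_eq_Ioi hrmp.le] at h2

/-- **The horizon form of the derivative of the matching function**:
`𝒲'(0) = C_m ( i K̇(r₊) P(r₊)² − ∫_{(r₊, ∞)} q̇ y₀² )`. [cite: ShlapentokhRothman2014KleinGordon, Lemma 4.5, §4.4] -/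
theorem MSetup.hasDerivAt_matchW_horizon (S : MSetup h m J c lam μ Cm C k S₁) :
    HasDerivAt (matchW m h J c) (Cm * (I * dK a m c (rPlus M a) * radCst M a m ^ 2 - ∫ r in Ioi (rPlus M a), dInt h m c r)) 0 := by
  have hcpos := hzC_pos h
  set rm := J.R₁ + 1 with hrm
  have hRr : rPlus M a < J.R₁ := (delta_ge_of_far h J.hR).2.2.1
  have hrmp : rPlus M a < rm := by rw [hrm]; linarith
  set z : ℂ := deriv (matchW m h J c) 0 with hz
  -- the derivative exists and equals the `r_h`-formula for every `r_h`
  have hformula : ∀ rh ∈ Ioo (rPlus M a) rm,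
      z = Cm * (betaW h m c rh - ∫ r in rh..rm, dInt h m c r) - Cm * ∫ r in Ioi rm, dInt h m c r := fun rh hrh ↦ by
    rw [hz, (S.hasDerivAt_matchW hrh).deriv]; rfl
  have hdiff : HasDerivAt (matchW m h J c) z 0 := by
    obtain ⟨rh, hrh⟩ : ∃ rh, rh ∈ Ioo (rPlus M a) rm := ⟨(rPlus M a + rm) / 2, by constructor <;> linarith⟩
    have h1 := S.hasDerivAt_matchW hrh
    exact h1.congr_deriv (by rw [hformula rh hrh]; rfl)
  -- integrability
  have hint := S.integrableOn_dInt
  have hint1 : IntegrableOn (dInt h m c) (Ioc (rPlus M a) rm) := hint.mono_set Ioc_subset_Ioi_self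
  have hint2 : IntegrableOn (dInt h m c) (Ioi rm) := hint.mono_set (Ioi_subset_Ioi hrmp.le)
  -- the limit of `∫_{rh}^{rm} g` as `rh → r₊⁺`
  have hprim : Tendsto (fun rh ↦ ∫ r in rh..rm, dInt h m c r) (𝓝[>] rPlus M a) (𝓝 (∫ r in (rPlus M a)..rm, dInt h m c r)) := by
    have hIcc : IntegrableOn (dInt h m c) (uIcc (rPlus M a) rm) := by
      rw [uIcc_of_le hrmp.le]
      exact (integrableOn_Icc_iff_integrableOn_Ioc (by simp)).2 hint1
    have hc := intervalIntegral.continuousOn_primitive_interval_left hIcc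
    have hcw : ContinuousWithinAt (fun rh ↦ ∫ r in rh..rm, dInt h m c r) (uIcc (rPlus M a) rm) (rPlus M a) := hc _ left_mem_uIcc
    rw [uIcc_of_le hrmp.le] at hcw
    have ht := hcw.tendsto
    rw [← nhdsWithin_Ioc_eq_nhdsGT hrmp]
    exact ht.mono_left (nhdsWithin_mono _ Ioc_subset_Icc_self)
  -- the two expressions agree near `r₊`, hence have the same limit
  set r₂ := min rm (rPlus M a + 2 * hzC M a / 5) with hr₂
  have hr₂p : rPlus M a < r₂ := lt_min hrmp (by linarith)
  have hev : ∀ᶠ rh in 𝓝[>] rPlus M a, Cm * betaH M a m c rh =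
      z + Cm * (∫ r in Ioi rm, dInt h m c r) + Cm * (∫ r in rh..rm, dInt h m c r) := by
    have hI : Ioo (rPlus M a) r₂ ∈ 𝓝[>] rPlus M a := Ioo_mem_nhdsGT hr₂p
    filter_upwards [hI] with rh hrh
    have h1 : rh ∈ Ioo (rPlus M a) rm := ⟨hrh.1, lt_of_lt_of_le hrh.2 (min_le_left _ _)⟩
    have h2 : rh ∈ Ioo (rPlus M a) (rPlus M a + 2 * hzC M a / 5) := ⟨hrh.1, lt_of_lt_of_le hrh.2 (min_le_right _ _)⟩
    have hf := hformula rh h1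
    rw [← S.betaW_eq_betaH h2]
    linear_combination -hf
  have hlim1 : Tendsto (fun rh ↦ Cm * betaH M a m c rh) (𝓝[>] rPlus M a) (𝓝 (Cm * (I * dK a m c (rPlus M a) * radCst M a m ^ 2))) :=
    S.tendsto_betaH.const_mul Cm
  have hlim2 : Tendsto (fun rh ↦ z + Cm * (∫ r in Ioi rm, dInt h m c r) + Cm * (∫ r in rh..rm, dInt h m c r)) (𝓝[>] rPlus M a)
      (𝓝 (z + Cm * (∫ r in Ioi rm, dInt h m c r) + Cm * (∫ r in (rPlus M a)..rm, dInt h m c r))) :=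
    tendsto_const_nhds.add (hprim.const_mul Cm)
  have heq := tendsto_nhds_unique (hlim1.congr' hev) hlim2
  -- split the integral over `(r₊, ∞)`
  have hsplit : (∫ r in Ioi (rPlus M a), dInt h m c r) = (∫ r in (rPlus M a)..rm, dInt h m c r) + (∫ r in Ioi rm, dInt h m c r) := by
    rw [intervalIntegral.integral_of_le hrmp.le, ← setIntegral_union Ioc_disjoint_Ioi_same measurableSet_Ioi hint1 hint2,
      Ioc_union_Ioi_eq_Ioi hrmp.le]
  have hzval : z = Cm * (I * dK a m c (rPlus M a) * radCst M a m ^ 2 - ∫ r in Ioi (rPlus M a), dInt h m c r) := by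
    rw [hsplit]
    linear_combination -heq
  rwa [hzval] at hdiff

end Horizon

end Literature.Barriers.FinalStateConjecture

end


/-!
# The two derivatives of the matching function at the real mode and their non-degeneracy

Topic `Literature/Barriers/FinalStateConjecture` (namespace `Literature.Barriers.FinalStateConjecture`),
continuing `KleinGordonMatchingHorizon.lean`. The horizon form of the derivative,
`𝒲'(0) = C_m( i K̇(r₊) P(r₊)² − ∫_{(r₊,∞)} q̇ y₀² )`, is evaluated along the two REAL parameter
curves through the threshold point `p₀ = (ω₀, λ, μ)` used by the implicit function theorem
(Shlapentokh-Rothman, CMP 329 (2014), §4.3):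

* the **mass direction** `c_μ(s) = (ω₀, Λ(s), μ + s)` (`Λ` real, `C¹`, `Λ(0) = λ`): `K̇ = 0`,
  `q̇ y₀² = P(r₊)²(Λ'(0) + 2μr²)u²`, so `∂_μ 𝒲 = −C_m P(r₊)² I₂` with the REAL
  `I₂ = ∫_{(r₊,∞)} (Λ'(0) + 2μr²) u² > 0` when `Λ'(0) ≥ 0`, `μ > 0` (`hasDerivAt_matchW_mu`, `I₂_pos`);
* the **frequency direction** `c_ω(s) = (ω₀ + s, Λ(s), μ)`: `K̇(r₊) = r₊² + a² = 2Mr₊`, `q̇` real, so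
  `∂_ω 𝒲 = C_m P(r₊)² (2Mr₊ i − J)` with `J` REAL (`hasDerivAt_matchW_omega`);
* hence the **Jacobian of `(Re 𝒲, Im 𝒲)` in `(ω_R, μ)` is invertible**:
  `Re z₁ · Im z₂ − Im z₁ · Re z₂ = |C_m P(r₊)²|² · 2Mr₊ · I₂ ≠ 0` (`jacobian_ne_zero`) — the ODE
  content of SR's Lemma 4.5 / the horizon flux `∂_ω Q_T(r₊) = −2Mr₊` (§4.4).

Everything is proved.

## References

* Y. Shlapentokh-Rothman, Comm. Math. Phys. 329 (2014) 859–891, §4.3 (Lemma 4.5, Prop. 4.2), §4.4.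
  Key `ShlapentokhRothman2014KleinGordon`.
-/

noncomputable section

open Set Filter Topology Complex MeasureTheory
open scoped ContDiff

namespace Literature.Barriers.FinalStateConjecture

open Literature.Geometry.Lorentzian Literature.Geometry.Lorentzian.Kerr Literature.Analysis.ODE

variable {M a : ℝ} {m : ℤ}

/-! ### The two curves -/

/-- **The mass direction** `c_μ(s) = (ω₀, Λ(s), μ + s)`. [cite: ShlapentokhRothman2014KleinGordon, §4.3] -/
def cMu (M a : ℝ) (m : ℤ) (Λr : ℝ → ℝ) (μ : ℝ) (s : ℝ) : HPar := ((kgOmega0 M a m : ℂ), ((Λr s : ℝ) : ℂ), μ + s)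

/-- **The frequency direction** `c_ω(s) = (ω₀ + s, Λ(s), μ)`. [cite: ShlapentokhRothman2014KleinGordon, §4.3] -/
def cOm (M a : ℝ) (m : ℤ) (Λr : ℝ → ℝ) (μ : ℝ) (s : ℝ) : HPar := (((kgOmega0 M a m + s : ℝ) : ℂ), ((Λr s : ℝ) : ℂ), μ)

variable {Λr : ℝ → ℝ} {μ : ℝ}

/-- `c_μ` is `C¹`. [folklore] -/
theorem contDiff_cMu (hΛ : ContDiff ℝ 1 Λr) : ContDiff ℝ 1 (cMu M a m Λr μ) := by
  unfold cMu
  refine contDiff_const.prodMk ((contDiff_ofReal_par.comp hΛ).prodMk ?_)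
  fun_prop

/-- `c_ω` is `C¹`. [folklore] -/
theorem contDiff_cOm (hΛ : ContDiff ℝ 1 Λr) : ContDiff ℝ 1 (cOm M a m Λr μ) := by
  unfold cOm
  refine ContDiff.prodMk ?_ ((contDiff_ofReal_par.comp hΛ).prodMk contDiff_const)
  fun_prop

/-- `ω̇ = 0` along `c_μ`. [folklore] -/
theorem dOmega_cMu : dOmega (cMu M a m Λr μ) = 0 := by
  unfold dOmega cMu; simp

/-- `ω̇ = 1` along `c_ω`. [folklore] -/
theorem dOmega_cOm : dOmega (cOm M a m Λr μ) = 1 := by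
  unfold dOmega cOm
  simp only
  have h1 : HasDerivAt (fun s : ℝ ↦ (((kgOmega0 M a m + s : ℝ)) : ℂ)) 1 0 := by
    have := ((hasDerivAt_id (0 : ℝ)).const_add (kgOmega0 M a m)).ofReal_comp
    simpa using this
  exact h1.deriv

/-- `Λ̇ = Λ'(0)` (as a complex number). [folklore] -/
theorem deriv_cg3_real (hΛ : ContDiff ℝ 1 Λr) (c : ℝ → HPar) (hc : ∀ s, (c s).2.1 = ((Λr s : ℝ) : ℂ)) :
    deriv (cg3 c) 0 = ((deriv Λr 0 : ℝ) : ℂ) := by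
  have hd : HasDerivAt Λr (deriv Λr 0) 0 := (hΛ.differentiable one_ne_zero 0).hasDerivAt
  have h1 : HasDerivAt (cg3 c) ((deriv Λr 0 : ℝ) : ℂ) 0 := by
    have := hd.ofReal_comp
    refine this.congr_of_eventuallyEq (Eventually.of_forall fun s ↦ ?_)
    simp [cg3, hc s]
  exact h1.deriv

/-- `η̇ = 2μ` along `c_μ`. [folklore] -/
theorem deriv_cg4_cMu : deriv (cg4 (cMu M a m Λr μ)) 0 = 2 * (μ : ℂ) := by
  have h1 : HasDerivAt (cg4 (cMu M a m Λr μ)) (2 * (μ : ℂ)) 0 := by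
    have h2 : HasDerivAt (fun s : ℝ ↦ (μ + s) ^ 2) (2 * μ) 0 := by
      have h1 : HasDerivAt (fun x : ℝ ↦ μ + x) 1 0 := (hasDerivAt_id (0 : ℝ)).const_add μ
      have := h1.mul h1
      refine (this.congr_of_eventuallyEq (Eventually.of_forall fun s ↦ ?_)).congr_deriv (by ring)
      simp [sq]
    have h3 := h2.ofReal_comp
    refine (h3.congr_of_eventuallyEq (Eventually.of_forall fun s ↦ ?_)).congr_deriv (by push_cast; ring)
    simp [cg4, cMu]
  exact h1.deriv

/-- `η̇ = 0` along `c_ω`. [folklore] -/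
theorem deriv_cg4_cOm : deriv (cg4 (cOm M a m Λr μ)) 0 = 0 := by
  unfold cg4 cOm; simp

/-! ### The derivative in the mass direction -/

section Mu

variable {h : IsSubextremal M a} {J : JD M a} {lam : ℝ} {Cm : ℂ} {C k S₁ : ℝ}

/-- **The real integrand of `∂_μ𝒲`**: `(Λ'(0) + 2μr²) u(r)²`. [folklore] -/
def muIntegrand (h : IsSubextremal M a) (m : ℤ) (Λr : ℝ → ℝ) (lam μ : ℝ) (r : ℝ) : ℝ :=
  (deriv Λr 0 + 2 * μ * r ^ 2) * radRe h m lam μ r ^ 2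

/-- Along `c_μ`: `q̇ y₀² = P(r₊)² (Λ'(0) + 2μr²) u²` on `(r₊, ∞)`. [folklore] -/
theorem dInt_cMu (S : MSetup h m J (cMu M a m Λr μ) lam μ Cm C k S₁) (hΛ : ContDiff ℝ 1 Λr) {r : ℝ} (hr : rPlus M a < r) :
    dInt h m (cMu M a m Λr μ) r = radCst M a m ^ 2 * ((muIntegrand h m Λr lam μ r : ℝ) : ℂ) := by
  have hΔ : 0 < delta M a r := delta_pos_of_gt h hr
  have hΔc : (delta M a r : ℂ) ≠ 0 := by exact_mod_cast hΔ.ne'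
  have hrmc : (((r - rMinus M a : ℝ)) : ℂ) ≠ 0 := by
    have : 0 < r - rMinus M a := by linarith [h.rMinus_lt_rPlus]
    exact_mod_cast this.ne'
  have hsq : ((Real.sqrt (delta M a r) : ℝ) : ℂ) ^ 2 = (delta M a r : ℂ) := by exact_mod_cast Real.sq_sqrt hΔ.le
  have hrmc' : ((r : ℂ) - rMinus M a) ≠ 0 := by
    have : (((r - rMinus M a : ℝ)) : ℂ) = (r : ℂ) - rMinus M a := by push_cast; ring
    rwa [this] at hrmc
  have hA : cA h m (cMu M a m Λr μ) 0 r = radCst M a m * (radV h m lam μ r : ℂ) := by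
    simp only [cA, S.hc0]; exact (yh_base_eq (m := m) h lam μ S.hpos hr).1
  have hvv : (radCst M a m * (radV h m lam μ r : ℂ)) * (radCst M a m * (radV h m lam μ r : ℂ)) =
      radCst M a m ^ 2 * (delta M a r : ℂ) * (radRe h m lam μ r : ℂ) ^ 2 := by
    rw [radV]; push_cast
    linear_combination (radCst M a m) ^ 2 * (radRe h m lam μ r : ℂ) ^ 2 * hsq
  have hΛd := deriv_cg3_real hΛ (cMu M a m Λr μ) (fun s ↦ rfl)
  rw [dInt, S.DQ_zero_eq hr, hA, mul_assoc, hvv, dQnum, dOmega_cMu, hΛd, deriv_cg4_cMu, muIntegrand]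
  push_cast
  field_simp
  ring

/-- The real integrand is integrable on `(r₊, ∞)`. [folklore] -/
theorem integrableOn_muIntegrand (S : MSetup h m J (cMu M a m Λr μ) lam μ Cm C k S₁) (hΛ : ContDiff ℝ 1 Λr) :
    IntegrableOn (muIntegrand h m Λr lam μ) (Ioi (rPlus M a)) := by
  have hI := S.integrableOn_dInt
  have hc : radCst M a m ^ 2 ≠ 0 := pow_ne_zero 2 radCst_ne_zero
  have h1 : IntegrableOn (fun r ↦ ((muIntegrand h m Λr lam μ r : ℝ) : ℂ)) (Ioi (rPlus M a)) := by
    have h2 : IntegrableOn (fun r ↦ (radCst M a m ^ 2)⁻¹ * dInt h m (cMu M a m Λr μ) r) (Ioi (rPlus M a)) := hI.const_mul _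
    refine h2.congr_fun (fun r hr ↦ ?_) measurableSet_Ioi
    show (radCst M a m ^ 2)⁻¹ * dInt h m (cMu M a m Λr μ) r = _
    rw [dInt_cMu S hΛ hr, ← mul_assoc, inv_mul_cancel₀ hc, one_mul]
  have h3 : IntegrableOn (fun r ↦ RCLike.re ((muIntegrand h m Λr lam μ r : ℝ) : ℂ)) (Ioi (rPlus M a)) := h1.re
  refine h3.congr_fun (fun r _ ↦ ?_) measurableSet_Ioi
  simp

/-- **`I₂ > 0`**: the mass integral is positive when `Λ'(0) ≥ 0` and `μ > 0` (`u > 0`). [folklore] -/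
theorem I₂_pos (S : MSetup h m J (cMu M a m Λr μ) lam μ Cm C k S₁) (hΛ : ContDiff ℝ 1 Λr) (hΛ' : 0 ≤ deriv Λr 0) (hμ : 0 < μ) :
    0 < ∫ r in Ioi (rPlus M a), muIntegrand h m Λr lam μ r := by
  have hrp : 0 ≤ rPlus M a := le_trans h.rMinus_nonneg h.rMinus_lt_rPlus.le
  have hpos : ∀ r ∈ Ioi (rPlus M a), 0 < muIntegrand h m Λr lam μ r := fun r hr ↦ by
    have hu := S.hpos r hr
    have hr0 : 0 < r := lt_of_le_of_lt hrp hr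
    unfold muIntegrand
    positivity
  rw [setIntegral_pos_iff_support_of_nonneg_ae]
  · have hsub : Ioi (rPlus M a) ⊆ Function.support (muIntegrand h m Λr lam μ) ∩ Ioi (rPlus M a) := fun r hr ↦
      ⟨(hpos r hr).ne', hr⟩
    refine lt_of_lt_of_le ?_ (measure_mono hsub)
    simp
  · exact (ae_restrict_mem measurableSet_Ioi).mono fun r hr ↦ (hpos r hr).le
  · exact integrableOn_muIntegrand S hΛ

/-- **The derivative in the mass direction**: `∂_μ𝒲 = −C_m P(r₊)² I₂`. [cite: ShlapentokhRothman2014KleinGordon, Lemma 4.5] -/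
theorem hasDerivAt_matchW_mu (S : MSetup h m J (cMu M a m Λr μ) lam μ Cm C k S₁) (hΛ : ContDiff ℝ 1 Λr) :
    HasDerivAt (matchW m h J (cMu M a m Λr μ))
      (-(Cm * radCst M a m ^ 2 * (((∫ r in Ioi (rPlus M a), muIntegrand h m Λr lam μ r : ℝ)) : ℂ))) 0 := by
  have hd := S.hasDerivAt_matchW_horizon
  have hK : dK a m (cMu M a m Λr μ) (rPlus M a) = 0 := by
    rw [S.dK_eq, show deriv (fun s ↦ (cMu M a m Λr μ s).1) 0 = dOmega (cMu M a m Λr μ) from rfl, dOmega_cMu, zero_mul]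
  have hI : (∫ r in Ioi (rPlus M a), dInt h m (cMu M a m Λr μ) r) =
      radCst M a m ^ 2 * (((∫ r in Ioi (rPlus M a), muIntegrand h m Λr lam μ r : ℝ)) : ℂ) := by
    rw [← integral_complex_ofReal, ← integral_const_mul]
    exact setIntegral_congr_fun measurableSet_Ioi fun r hr ↦ dInt_cMu S hΛ hr
  refine hd.congr_deriv ?_
  rw [hK, hI]; ring

end Mu

/-! ### The derivative in the frequency direction -/

section Om

variable {h : IsSubextremal M a} {J : JD M a} {lam : ℝ} {Cm : ℂ} {C k S₁ : ℝ}

/-- **The real integrand of `∂_ω𝒲`**: `(−2ω₀ r(r² + r₊r + r₊² + a²)/(r − r₋) + Λ'(0)) u(r)²`. [folklore] -/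
def omIntegrand (h : IsSubextremal M a) (m : ℤ) (Λr : ℝ → ℝ) (lam μ : ℝ) (r : ℝ) : ℝ :=
  (-2 * kgOmega0 M a m * r * (r ^ 2 + rPlus M a * r + rPlus M a ^ 2 + a ^ 2) / (r - rMinus M a) + deriv Λr 0) * radRe h m lam μ r ^ 2

/-- Along `c_ω`: `q̇ y₀² = P(r₊)² · omIntegrand` on `(r₊, ∞)` (a REAL function times `P(r₊)²`). [folklore] -/
theorem dInt_cOm (S : MSetup h m J (cOm M a m Λr μ) lam μ Cm C k S₁) (hΛ : ContDiff ℝ 1 Λr) {r : ℝ} (hr : rPlus M a < r) :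
    dInt h m (cOm M a m Λr μ) r = radCst M a m ^ 2 * ((omIntegrand h m Λr lam μ r : ℝ) : ℂ) := by
  have hΔ : 0 < delta M a r := delta_pos_of_gt h hr
  have hΔc : (delta M a r : ℂ) ≠ 0 := by exact_mod_cast hΔ.ne'
  have hrm0 : 0 < r - rMinus M a := by linarith [h.rMinus_lt_rPlus]
  have hrmc : (((r - rMinus M a : ℝ)) : ℂ) ≠ 0 := by exact_mod_cast hrm0.ne'
  have hrmc' : ((r : ℂ) - rMinus M a) ≠ 0 := by
    have : (((r - rMinus M a : ℝ)) : ℂ) = (r : ℂ) - rMinus M a := by push_cast; ring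
    rwa [this] at hrmc
  have hsq : ((Real.sqrt (delta M a r) : ℝ) : ℂ) ^ 2 = (delta M a r : ℂ) := by exact_mod_cast Real.sq_sqrt hΔ.le
  have hA : cA h m (cOm M a m Λr μ) 0 r = radCst M a m * (radV h m lam μ r : ℂ) := by
    simp only [cA, S.hc0]; exact (yh_base_eq (m := m) h lam μ S.hpos hr).1
  have hvv : (radCst M a m * (radV h m lam μ r : ℂ)) * (radCst M a m * (radV h m lam μ r : ℂ)) =
      radCst M a m ^ 2 * (delta M a r : ℂ) * (radRe h m lam μ r : ℂ) ^ 2 := by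
    rw [radV]; push_cast
    linear_combination (radCst M a m) ^ 2 * (radRe h m lam μ r : ℂ) ^ 2 * hsq
  have hΛd := deriv_cg3_real hΛ (cOm M a m Λr μ) (fun s ↦ rfl)
  rw [dInt, S.DQ_zero_eq hr, hA, mul_assoc, hvv, dQnum, dOmega_cOm, hΛd, deriv_cg4_cOm, omIntegrand]
  push_cast
  field_simp
  ring

/-- **The derivative in the frequency direction**: `∂_ω𝒲 = C_m P(r₊)² (2Mr₊ i − J)`, `J` real. [cite: ShlapentokhRothman2014KleinGordon, Lemma 4.5, §4.4] -/
theorem hasDerivAt_matchW_omega (S : MSetup h m J (cOm M a m Λr μ) lam μ Cm C k S₁) (hΛ : ContDiff ℝ 1 Λr) :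
    HasDerivAt (matchW m h J (cOm M a m Λr μ))
      (Cm * radCst M a m ^ 2 * (2 * M * rPlus M a * I - (((∫ r in Ioi (rPlus M a), omIntegrand h m Λr lam μ r : ℝ)) : ℂ))) 0 := by
  have hd := S.hasDerivAt_matchW_horizon
  have hsq : rPlus M a ^ 2 + a ^ 2 = 2 * M * rPlus M a := by
    have h0 := delta_rPlus h.le
    unfold delta at h0
    linarith
  have hK : dK a m (cOm M a m Λr μ) (rPlus M a) = 2 * M * rPlus M a := by
    rw [S.dK_eq, show deriv (fun s ↦ (cOm M a m Λr μ s).1) 0 = dOmega (cOm M a m Λr μ) from rfl, dOmega_cOm, one_mul]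
    exact_mod_cast hsq
  have hI : (∫ r in Ioi (rPlus M a), dInt h m (cOm M a m Λr μ) r) =
      radCst M a m ^ 2 * (((∫ r in Ioi (rPlus M a), omIntegrand h m Λr lam μ r : ℝ)) : ℂ) := by
    rw [← integral_complex_ofReal, ← integral_const_mul]
    exact setIntegral_congr_fun measurableSet_Ioi fun r hr ↦ dInt_cOm S hΛ hr
  refine hd.congr_deriv ?_
  rw [hK, hI]; ring

end Om

/-! ### Non-degeneracy of the Jacobian -/

/-- **The Jacobian determinant.** For `z₁ = w(2Mr₊ i − J)`, `z₂ = −w I₂` with `w ≠ 0`, `J ∈ ℝ`,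
`I₂ > 0`, `M r₊ > 0`: `Re z₁ · Im z₂ − Im z₁ · Re z₂ = ‖w‖² · 2Mr₊ · I₂ ≠ 0`. [folklore] -/
theorem jacobian_ne_zero {w : ℂ} (hw : w ≠ 0) {Mr Jr I₂ : ℝ} (hMr : 0 < Mr) (hI : 0 < I₂) :
    (w * (Mr * I - (Jr : ℂ))).re * (-(w * (I₂ : ℂ))).im - (w * (Mr * I - (Jr : ℂ))).im * (-(w * (I₂ : ℂ))).re ≠ 0 := by
  have key : (w * (Mr * I - (Jr : ℂ))).re * (-(w * (I₂ : ℂ))).im - (w * (Mr * I - (Jr : ℂ))).im * (-(w * (I₂ : ℂ))).re =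
      (w.re ^ 2 + w.im ^ 2) * Mr * I₂ := by
    simp only [Complex.mul_re, Complex.mul_im, Complex.sub_re, Complex.sub_im, Complex.neg_re, Complex.neg_im, Complex.I_re,
      Complex.I_im, Complex.ofReal_re, Complex.ofReal_im, mul_zero, mul_one, zero_sub, sub_zero, add_zero]
    ring
  rw [key]
  have hw2 : 0 < w.re ^ 2 + w.im ^ 2 := by
    rcases Complex.ext_iff.not.1 hw |> not_and_or.1 with h1 | h1
    · have : w.re ≠ 0 := by simpa using h1
      positivity
    · have : w.im ≠ 0 := by simpa using h1
      positivity
  positivity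

end Literature.Barriers.FinalStateConjecture

end
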